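import Literature.NumberTheory.LFunctions.CriticalLineTwoThirdsPrimeTermProofs
import Literature.NumberTheory.LFunctions.VonMangoldtSqHarmonicMoments
import HarnessLib

/-!
# RH-FREE — «nothing here bears on the truth of RH»: Alpöge–Furman 2026 (arXiv:2608.13637) Theorem 5.7 (`‖G̃‖²_HS = (R(ψ) + O(L⁻¹)) N(T,2T)`) — PROVED for the typed model: `AlpogeFurman2026_hilbertSchmidt_holds`

Topic `Literature/NumberTheory/LFunctions` (namespace `Literature.NumberTheory.LFunctions.AlpogeFurman2026`).
Cell `rh-columns/lit`, unit `rh-lit-frontier-1` (gen 8). Source: **[AF26]** L. Alpöge, R. Furman,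
*More than two thirds of the zeros of the Riemann zeta function are simple and on the critical
line*, arXiv:2608.13637v2 (19 Aug 2026), UNREFEREED preprint (D-0012); locators = printed
proposition / equation numbers and pages of v2. This file has NO definition, NO claim and NO
`sorry`: it DISCHARGES the tree's claim `AlpogeFurman2026_hilbertSchmidt`
(`CriticalLineTwoThirdsMatrix.lean`, [AF26] Theorem 5.7 for the typed objects `G̃ = gramMatrix ψ T`,
`R(ψ) = windowConstant ψ`, `N(T,2T) = zetaZeroCount (2T) − zetaZeroCount T`, `L = logHeight T`) by
the theorem `AlpogeFurman2026_hilbertSchmidt_holds`, assembled — exactly as in the printed proof —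
from the companion proof files: Proposition 4.3 / the tail `Ẽ`
(`AlpogeFurman2026_trace_sq_perturbation`, `CriticalLineTwoThirdsPrimeSideSetup`), Proposition 5.2
(`AlpogeFurman2026_reduction`, `CriticalLineTwoThirdsReduction`), Proposition 5.3
(`AlpogeFurman2026_arch_term`), Proposition 5.5 (`AlpogeFurman2026_formM_split`,
`AlpogeFurman2026_cross_arch_prime`) (`CriticalLineTwoThirdsArchProofs`), Proposition 5.4
(`AlpogeFurman2026_prime_term`, `CriticalLineTwoThirdsPrimeTermProofs`), Lemma 5.1 (5.5)
(`AlpogeFurman2026_sum_vonMangoldt_sq_div`, `VonMangoldtSqHarmonicMoments`), and the explicit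
Riemann–von Mangoldt formula of the tree (`abs_zetaZeroCount_sub_main_le_explicit'`,
`dyadic_count_ge`).

## What the source prints (Theorem 5.7 and its proof, p. 11)

"**Theorem 5.7.** `‖G̃‖²_HS = (R(ψ) + O_χ(L⁻¹)) N(T,2T)`. *Proof.* By Propositions 5.2–5.5,
`‖G̃+Ẽ‖²_HS = (a²L²)⁻¹(𝓜[μ,μ] + 𝓜[P_X,P_X] + O(L²√X)) + O(N log L/L²)`. Rescaling
`φ²(u) = ψ(u/L) + O(𝟙_{|u|>L/2−1})` gives `‖φ‖₂² = L∫ψ + O_χ(1)`, `‖φ‖₄⁴ = L∫ψ² + O_χ(1)`,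
`g(y) = L(ψ∗ψ)(y/L) + O_χ(1)` uniformly; so `Σ_{n≤X}(Λ(n)²/n)g(log n) = LΣ_n(Λ(n)²/n)(ψ∗ψ)(log n/L)
+ O_χ(L²)`, and by partial summation with `Σ_{n≤t}Λ(n)²/n = ½log²t + O(log t)` this equals
`L³∫_0^1 w(ψ∗ψ)(w)dw + O_χ(L²)`. Thus `𝓜[μ,μ] + 𝓜[P_X,P_X] = (TL³/2π)(∫ψ² + 2∫_0^1 w(ψ∗ψ)) + O_χ(TL²)
= (TL³/2π)R(ψ)(∫ψ)² + O_χ(TL²)` by Lemma 5.6 (since `2∫_0^1 w(ψ∗ψ) = ∬|u−v|ψψ`, `ψ` even). Dividing by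
`a²L² = L²(∫ψ)² + O_χ(L)`: `‖G̃+Ẽ‖²_HS = R(ψ)·TL/2π + O_χ(T) = R(ψ)N(T,2T) + O_χ(N/L)`. Finally
`|‖G̃‖²_HS − ‖G̃+Ẽ‖²_HS| ≤ 2‖G̃+Ẽ‖_HS‖Ẽ‖_HS + ‖Ẽ‖²_HS ≪ √N·T^{−1/2}` by Proposition 4.3."

## What is here (typed model `φ_T = χχ√ψ(·/L)`, `X = T/2π`), following the printed proof

* §H1 the derivative of `φ_T²` (`exists_hasDerivAt_phi_sq`: a continuous `d = (φ_T²)′` with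
  `∫|d| ≤ K` uniformly in `L ≥ 1` — the printed "`‖(φ²)′‖₁ ≪_χ 1`"), from `φ_T² = χ²(L/2+u)χ²(L/2−u)
  ψ(clamp(u/L))` (product rule inside `(−L/2, L/2)`, a squeeze `0 ≤ φ² ≤ M·χ²χ²` at and beyond `±L/2`).
* §H2 the partial summation, organised with the variable `u` of `g(y) = ∫φ²(u)φ²(y−u)du` OUTSIDE
  (the deviation from print: we sum `Σ_n(Λ(n)²/n)φ_T²(log n − u)` by parts for each `u` — Mathlib's
  Abel summation `sum_mul_eq_sub_integral_mul₀`, the substitution `t = e^y`, one integration by parts —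
  and only then integrate against `φ_T²(u)`; this avoids differentiating the convolution `g` and the
  intermediate `ψ∗ψ`): `|Σ_n(Λ(n)²/n)φ_T²(log n − u) − ∫_0^L yφ_T²(y−u)dy| ≤ (CL+1)(M+K)` uniformly
  in `u` (`abs_sum_phi_sq_sub_integral_le`).
* §H3 `Σ_n(Λ(n)²/n)g(log n) = ∫φ_T²(u)[Σ_n …]du` and hence `= ∫φ_T²(v)(∫_0^L yφ_T²(y−v)dy)dv + O(L²)`
  (`abs_sum_gConv_sub_le`).
* §H4 `∫φ_T²(v)∫_0^L yφ_T²(y−v) = ½∫φ_T²(v)∫_{−L/2}^{L/2}|v+x|φ_T²(x)` (reflection `v ↦ −v`, the printed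
  "`2∫_0^1 w(ψ∗ψ) = ∬|u−v|ψψ`"), the rescaling `φ_T² → ψ(·/L)` at cost `4M²L²`
  (`integral_abs_phi_sq_sub_clamp_le`: `∫_{−L/2}^{L/2}|φ_T² − ψ(·/L)| ≤ 2M`, the printed
  "`φ²(u) = ψ(u/L) + O(𝟙_{|u|>L/2−1})`"), and `∬_{[−L/2,L/2]²}|v+x|ψ(v/L)ψ(x/L) = L³∬|s−t|ψ(s)ψ(t)`
  (`double_clamp_eq`, `ψ` even); together **`exists_sum_gConv_bound`**:
  `|Σ_{n≤X}(Λ(n)²/n)g(log n) − (L³/2)∬|s−t|ψψ| ≤ C L²`.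
* §H5 `|N(2T) − N(T) − TL/2π| ≤ T` for `T ≥ 260` (`abs_dyadic_count_sub_le`).
* §H6 the window algebra of Lemma 5.6 (`window_algebra`: with `F₂ = ∫φ² = L∫ψ + O(1)`,
  `F₄ = ∫φ⁴ = L∫ψ² + O(1)`, `R(∫ψ)² = ∫ψ² + ∬|s−t|ψψ`: `LF₄ + L²D − RF₂² = O(L)`) and the assembly
  **`AlpogeFurman2026_hilbertSchmidt_holds`**: `𝓜 = (TL/2π)R F₂² + O(TL²)`, `Σs² = L²𝓜 + O(TL⁴)`,
  `(LF₂)⁻²Σs² = R·TL/2π + O(T) = R·N(T,2T) + O(T)`, `tr G̃² = (LF₂)⁻²Σs² + O(√(TL)·T^{−1/2})`, and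
  `O(T) = O(N(T,2T)/L)` by `N(T,2T) ≥ TL/4π`; with `T₀ = max(300, 2πe^{10})` and an explicit `C(ψ)`.

DEVIATIONS (recorded, no endorsement either way): every printed `O_χ(·)` is an explicit constant
depending on the window (floor `m₀`, sup `B²`, `sup|ψ′|`) and on the fixed ramp
`χ = Real.smoothTransition`; the precision kept throughout is `O(TL²)` for `𝓜` (the printed
`O(L²√X)` for the cross terms is not needed and not reproduced); the `u`-outside organisation of the
partial summation (§H2) replaces the printed route through `g = L(ψ∗ψ)(·/L) + O(1)`.

STATUS NOTE (no endorsement). This completes a sorry-free Lean proof, for the tree's typed model of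
[AF26] §2, of the printed Theorem 5.7 — an unconditional mean-value statement about the compressed
Weil matrix built from the zeros of `ζ` in `[T − √T, 2T + √T)`. It is ONE of the two analytic inputs
of [AF26]'s §6; the other uses of the paper (Theorem A: "more than two thirds of the zeros are simple
and on the line") are NOT asserted here, and nothing here bears on RH. [AF26] is an unrefereed
preprint; the faithfulness of the typed objects to the printed ones is recorded in
`CriticalLineTwoThirdsMatrix.lean`.

## References
* [AlpogeFurman2026] as above: Theorem 5.7 and its proof, Lemma 5.6 eq. (5.10) (p. 11);
  Propositions 5.2–5.5 (pp. 8–10); Lemma 5.1 (5.5) (p. 7); §2.2 eq. (2.8) (p. 4); §1.1 (p. 1).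
* [Titchmarsh1986] E. C. Titchmarsh, *The theory of the Riemann zeta-function*, 2nd ed., OUP 1986,
  Thm. 9.4 (Riemann–von Mangoldt) — via the tree's explicit form `abs_zetaZeroCount_sub_main_le_explicit'`.
-/

noncomputable section

open Complex Filter Set MeasureTheory Asymptotics
open scoped Real Topology ArithmeticFunction.vonMangoldt

namespace Literature.NumberTheory.LFunctions

namespace AlpogeFurman2026

variable {ψ : ℝ → ℝ}

/-! ## §H1. Flat `C²` ramps and the derivative of `φ_T²`

`φ_T(u)² = r(L/2+u) r(L/2−u) ψ(clamp(u/L))` with the flat `C²` ramp `r = χ²`; its derivative is the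
continuous function `d(u) = [r′(L/2+u)r(L/2−u) − r(L/2+u)r′(L/2−u)] ψ(clamp(u/L)) +
r(L/2+u)r(L/2−u) ψ′(clamp(u/L))/L` (`ψ′ = derivWithin ψ [−½,½]`), which vanishes for `|u| ≥ L/2`
and has `∫|d| ≤ 2M∫|r′| + sup|ψ′|` uniformly in `L ≥ 1` — the printed "`‖(φ²)′‖₁ ≪_χ 1`". -/

section Ramp

variable {r : ℝ → ℝ}

/-- A flat ramp is locally `0` left of `0`, so `r′ = 0` there. [cite: AlpogeFurman2026, §2.2 (p. 4: "`χ|_{(−∞,0]} = 0`")] -/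
private theorem deriv_ramp_eq_zero_of_neg (hr0 : ∀ x ≤ (0 : ℝ), r x = 0) {x : ℝ} (hx : x < 0) :
    deriv r x = 0 := by
  have h : r =ᶠ[𝓝 x] fun _ ↦ (0 : ℝ) := by
    filter_upwards [Iio_mem_nhds hx] with t ht using hr0 t (le_of_lt ht)
  rw [h.deriv_eq, deriv_const]

/-- … and locally `1` right of `1`, so `r′ = 0` there. [cite: AlpogeFurman2026, §2.2 (p. 4: "`χ|_{[1,∞)} = 1`")] -/
private theorem deriv_ramp_eq_zero_of_one_lt (hr1 : ∀ x, (1 : ℝ) ≤ x → r x = 1) {x : ℝ} (hx : 1 < x) :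
    deriv r x = 0 := by
  have h : r =ᶠ[𝓝 x] fun _ ↦ (1 : ℝ) := by
    filter_upwards [Ioi_mem_nhds hx] with t ht using hr1 t (le_of_lt ht)
  rw [h.deriv_eq, deriv_const]

/-- By continuity of `r′`, `r′(x) = 0` for all `x ≤ 0`. [cite: AlpogeFurman2026, §2.2 (p. 4)] -/
private theorem deriv_ramp_eq_zero_of_nonpos (hr : ContDiff ℝ 2 r) (hr0 : ∀ x ≤ (0 : ℝ), r x = 0)
    {x : ℝ} (hx : x ≤ 0) : deriv r x = 0 := by
  have hc : Continuous (deriv r) := hr.continuous_deriv (by norm_num)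
  have hcl : IsClosed {x : ℝ | deriv r x = 0} := isClosed_eq hc continuous_const
  have hsub : Iio (0 : ℝ) ⊆ {x : ℝ | deriv r x = 0} := fun x hx ↦ deriv_ramp_eq_zero_of_neg hr0 hx
  have hx' : x ∈ closure (Iio (0 : ℝ)) := by rw [closure_Iio]; exact hx
  exact hcl.closure_subset_iff.2 hsub hx'

/-- `r′` is continuous and integrable (it vanishes off `[0,1]`). [cite: AlpogeFurman2026, §2.2 (p. 4)] -/
private theorem integrable_deriv_ramp (hr : ContDiff ℝ 2 r) (hr0 : ∀ x ≤ (0 : ℝ), r x = 0)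
    (hr1 : ∀ x, (1 : ℝ) ≤ x → r x = 1) : Continuous (deriv r) ∧ Integrable (deriv r) := by
  have hc : Continuous (deriv r) := hr.continuous_deriv (by norm_num)
  refine ⟨hc, hc.integrable_of_hasCompactSupport ?_⟩
  refine HasCompactSupport.intro (isCompact_Icc (a := (0 : ℝ)) (b := 1)) fun x hx ↦ ?_
  rw [mem_Icc, not_and_or, not_le, not_le] at hx
  rcases hx with hx | hx
  · exact deriv_ramp_eq_zero_of_neg hr0 hx
  · exact deriv_ramp_eq_zero_of_one_lt hr1 hx

/-- `(r(L/2+u) r(L/2−u))′ = r′(L/2+u) r(L/2−u) − r(L/2+u) r′(L/2−u)`. [cite: AlpogeFurman2026, §2.2 eq. (2.8) (p. 4)] -/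
private theorem hasDerivAt_rampProd (hr : ContDiff ℝ 2 r) (L u : ℝ) :
    HasDerivAt (fun u : ℝ ↦ r (L / 2 + u) * r (L / 2 - u))
      (deriv r (L / 2 + u) * r (L / 2 - u) - r (L / 2 + u) * deriv r (L / 2 - u)) u := by
  have hd : Differentiable ℝ r := hr.differentiable (by norm_num)
  have h1 : HasDerivAt (fun u : ℝ ↦ r (L / 2 + u)) (deriv r (L / 2 + u)) u :=
    HasDerivAt.comp_const_add (L / 2) u (hd (L / 2 + u)).hasDerivAt
  have h2 : HasDerivAt (fun u : ℝ ↦ r (L / 2 - u)) (-deriv r (L / 2 - u)) u :=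
    HasDerivAt.comp_const_sub (L / 2) u (hd (L / 2 - u)).hasDerivAt
  exact (h1.mul h2).congr_deriv (by ring)

/-- Off `(−L/2, L/2)` the product and its derivative vanish. [cite: AlpogeFurman2026, §2.2 (p. 4: "`supp φ = [−L/2, L/2]`")] -/
private theorem rampProd_eq_zero (hr : ContDiff ℝ 2 r) (hr0 : ∀ x ≤ (0 : ℝ), r x = 0) {L u : ℝ}
    (hu : L / 2 ≤ |u|) :
    r (L / 2 + u) * r (L / 2 - u) = 0 ∧
      deriv r (L / 2 + u) * r (L / 2 - u) - r (L / 2 + u) * deriv r (L / 2 - u) = 0 := by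
  rcases le_or_gt 0 u with h | h
  · rw [abs_of_nonneg h] at hu
    have h1 : r (L / 2 - u) = 0 := hr0 _ (by linarith)
    have h2 : deriv r (L / 2 - u) = 0 := deriv_ramp_eq_zero_of_nonpos hr hr0 (by linarith)
    rw [h1, h2]; constructor <;> ring
  · rw [abs_of_neg h] at hu
    have h1 : r (L / 2 + u) = 0 := hr0 _ (by linarith)
    have h2 : deriv r (L / 2 + u) = 0 := deriv_ramp_eq_zero_of_nonpos hr hr0 (by linarith)
    rw [h1, h2]; constructor <;> ring

end Ramp

/-- On `(−L/2, L/2)` the clamp is inactive near any point. [cite: AlpogeFurman2026, §2.2 (p. 4)] -/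
private theorem clampHalf_div_eventuallyEq' {L u : ℝ} (hL : 0 < L) (hu : u ∈ Ioo (-(L / 2)) (L / 2)) :
    (fun v : ℝ ↦ clampHalf (v / L)) =ᶠ[𝓝 u] fun v ↦ v / L := by
  filter_upwards [Ioo_mem_nhds hu.1 hu.2] with v hv
  refine clampHalf_of_mem ⟨?_, ?_⟩
  · rw [le_div_iff₀ hL]; linarith [hv.1]
  · rw [div_le_iff₀ hL]; linarith [hv.2]

/-- `u ∈ (−L/2, L/2) ⇒ u/L ∈ (−½, ½)`. [cite: AlpogeFurman2026, §2.2 (p. 4)] -/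
private theorem div_mem_Ioo_half' {L u : ℝ} (hL : 0 < L) (hu : u ∈ Ioo (-(L / 2)) (L / 2)) :
    u / L ∈ Ioo (-(1 / 2 : ℝ)) (1 / 2) := by
  constructor
  · rw [lt_div_iff₀ hL]; linarith [hu.1]
  · rw [div_lt_iff₀ hL]; linarith [hu.2]

/-- Chain rule through the inactive clamp. [cite: AlpogeFurman2026, §2.2 (p. 4)] -/
private theorem hasDerivAt_comp_clampHalf_div {q : ℝ → ℝ} {q' L u : ℝ} (hL : 0 < L)
    (hu : u ∈ Ioo (-(L / 2)) (L / 2)) (hq : HasDerivAt q q' (u / L)) :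
    HasDerivAt (fun v : ℝ ↦ q (clampHalf (v / L))) (q' / L) u := by
  have h1 : HasDerivAt (fun v : ℝ ↦ q (v / L)) (q' / L) u := by
    have := hq.comp u ((hasDerivAt_id u).div_const L)
    simpa [Function.comp_def, div_eq_mul_inv, mul_comm] using this
  refine h1.congr_of_eventuallyEq ?_
  filter_upwards [clampHalf_div_eventuallyEq' hL hu] with v hv
  rw [hv]

/-- Interior derivative from `C¹` data on `[−½, ½]`. [cite: AlpogeFurman2026, §2.2 (p. 4)] -/
private theorem hasDerivAt_of_differentiableOn_half {q : ℝ → ℝ}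
    (hq : DifferentiableOn ℝ q (Icc (-(1 / 2 : ℝ)) (1 / 2))) {x : ℝ} (hx : x ∈ Ioo (-(1 / 2 : ℝ)) (1 / 2)) :
    HasDerivAt q (derivWithin q (Icc (-(1 / 2 : ℝ)) (1 / 2)) x) x := by
  have hmem : Icc (-(1 / 2 : ℝ)) (1 / 2) ∈ 𝓝 x := Icc_mem_nhds hx.1 hx.2
  exact ((hq x (Ioo_subset_Icc_self hx)).hasDerivWithinAt).hasDerivAt hmem

/-- `φ_T² = r(L/2+u) r(L/2−u) ψ(clamp(u/L))` with `r = χ²`. [cite: AlpogeFurman2026, §2.2 eq. (2.8) (p. 4)] -/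
theorem phi_sq_eq_rampProd (hψ : IsWindow ψ) (T u : ℝ) :
    phi ψ T u ^ 2 = smoothRamp (logHeight T / 2 + u) ^ 2 * smoothRamp (logHeight T / 2 - u) ^ 2 *
      ψ (clampHalf (u / logHeight T)) := by
  have hsq : Real.sqrt (ψ (clampHalf (u / logHeight T))) ^ 2 = ψ (clampHalf (u / logHeight T)) :=
    Real.sq_sqrt (hψ.pos _ (clampHalf_mem _)).le
  simp only [phi]
  rw [mul_pow, mul_pow, hsq]

/-- `φ_T² ≤ M` pointwise when `ψ ≤ M` on `[−½,½]`. [cite: AlpogeFurman2026, §2.2 (p. 4: "`0 ≤ φ ≤ 1`")] -/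
theorem phi_sq_le (hψ : IsWindow ψ) {M : ℝ} (hM : ∀ x ∈ Icc (-(1 / 2 : ℝ)) (1 / 2), ψ x ≤ M) (T u : ℝ) :
    phi ψ T u ^ 2 ≤ M :=
  (phi_sq_le_clamp hψ T u).trans (hM _ (clampHalf_mem _))

/-- `φ_T(u)² = 0` for `|u| ≥ L/2`. [cite: AlpogeFurman2026, §2.2 (p. 4)] -/
theorem phi_sq_eq_zero_of_le_abs {T u : ℝ} (hu : logHeight T / 2 ≤ |u|) : phi ψ T u ^ 2 = 0 := by
  rw [phi_eq_zero_of_le_abs hu]; ring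

/-- **The derivative of `φ_T²` and `‖(φ_T²)′‖₁ ≪ 1`.** For a window `ψ` there is `K ≥ 0` such that for
every `T` with `L ≥ 1` the function `φ_T²` is differentiable on `ℝ` with a continuous derivative `d`
vanishing for `|u| ≥ L/2`, integrable, with `∫_ℝ |d| ≤ K` (the ramp derivatives live on two unit
intervals, the core contributes `sup|ψ′|/L` over a length `L`).
[cite: AlpogeFurman2026, §2.2 eq. (2.8) (p. 4: "`‖φ′‖₁ ≪_χ 1`"); §5.1 (5.3) (p. 7)] -/
theorem exists_hasDerivAt_phi_sq (hψ : IsWindow ψ) :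
    ∃ K : ℝ, 0 ≤ K ∧ ∀ T : ℝ, 1 ≤ logHeight T →
      ∃ d : ℝ → ℝ, Continuous d ∧ (∀ u, HasDerivAt (fun v ↦ phi ψ T v ^ 2) (d u) u) ∧
        (∀ u, logHeight T / 2 ≤ |u| → d u = 0) ∧ Integrable d ∧ ∫ u, |d u| ≤ K := by
  set J : Set ℝ := Icc (-(1 / 2 : ℝ)) (1 / 2) with hJ
  -- window constants: `ψ ≤ M`, `|ψ′| ≤ B₁` on `J`
  obtain ⟨m₀, B, K₀, -, hB0, -, -, hB, -⟩ := hψ.exists_bounds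
  have hM : ∀ x ∈ J, ψ x ≤ B ^ 2 := hψ.le_sq_of_sqrt_le hB
  set M : ℝ := B ^ 2 with hMdef
  have hM0 : 0 ≤ M := sq_nonneg _
  have hud : UniqueDiffOn ℝ J := uniqueDiffOn_Icc (by norm_num)
  have hdc : ContinuousOn (derivWithin ψ J) J := hψ.contDiffOn.continuousOn_derivWithin hud (by norm_num)
  have hdiff : DifferentiableOn ℝ ψ J := hψ.contDiffOn.differentiableOn (by norm_num)
  obtain ⟨B₁', hB₁'⟩ := (isCompact_Icc (a := -(1 / 2 : ℝ)) (b := 1 / 2)).exists_bound_of_continuousOn hdc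
  set B₁ : ℝ := max B₁' 0 with hB₁def
  have hB₁0 : 0 ≤ B₁ := le_max_right _ _
  have hB₁ : ∀ x ∈ J, |derivWithin ψ J x| ≤ B₁ := fun x hx ↦
    (Real.norm_eq_abs _ ▸ hB₁' x hx).trans (le_max_left _ _)
  -- the ramp `r = χ²`
  obtain ⟨hr, hr0, hr1⟩ := smoothRamp_sq_ramp
  set r : ℝ → ℝ := fun x ↦ smoothRamp x ^ 2 with hrdef
  obtain ⟨hrc1, hri1⟩ := integrable_deriv_ramp hr hr0 hr1
  have hrc : Continuous r := hr.continuous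
  have hr01 : ∀ x, 0 ≤ r x ∧ r x ≤ 1 := fun x ↦ by
    refine ⟨sq_nonneg _, ?_⟩
    have h0 := smoothRamp_nonneg x
    have h1 := smoothRamp_le_one x
    show smoothRamp x ^ 2 ≤ 1
    nlinarith
  have hrabs : ∀ x, |r x| ≤ 1 := fun x ↦ by rw [abs_of_nonneg (hr01 x).1]; exact (hr01 x).2
  set I₁ : ℝ := ∫ x, |deriv r x| with hI₁
  have hI₁0 : 0 ≤ I₁ := integral_nonneg fun x ↦ abs_nonneg _
  refine ⟨2 * M * I₁ + B₁, by positivity, fun T hT ↦ ?_⟩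
  set L := logHeight T with hLdef
  have hL0 : 0 < L := by linarith
  -- the derivative
  set d : ℝ → ℝ := fun u ↦
    (deriv r (L / 2 + u) * r (L / 2 - u) - r (L / 2 + u) * deriv r (L / 2 - u)) *
        ψ (clampHalf (u / L)) +
      r (L / 2 + u) * r (L / 2 - u) * (derivWithin ψ J (clampHalf (u / L)) / L) with hddef
  have hphi2 : ∀ v, phi ψ T v ^ 2 = r (L / 2 + v) * r (L / 2 - v) * ψ (clampHalf (v / L)) :=
    fun v ↦ phi_sq_eq_rampProd hψ T v
  have hclampc : Continuous fun u : ℝ ↦ clampHalf (u / L) :=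
    continuous_clampHalf.comp (continuous_id.div_const _)
  have hψc : Continuous fun u : ℝ ↦ ψ (clampHalf (u / L)) := hψ.continuous_clamp L
  have hψ'c : Continuous fun u : ℝ ↦ derivWithin ψ J (clampHalf (u / L)) :=
    hdc.comp_continuous hclampc fun u ↦ clampHalf_mem _
  have hdcont : Continuous d := by
    have h1 : Continuous fun u : ℝ ↦ deriv r (L / 2 + u) := hrc1.comp (continuous_const.add continuous_id)
    have h2 : Continuous fun u : ℝ ↦ deriv r (L / 2 - u) := hrc1.comp (continuous_const.sub continuous_id)
    have h3 : Continuous fun u : ℝ ↦ r (L / 2 + u) := hrc.comp (continuous_const.add continuous_id)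
    have h4 : Continuous fun u : ℝ ↦ r (L / 2 - u) := hrc.comp (continuous_const.sub continuous_id)
    exact (((h1.mul h4).sub (h3.mul h2)).mul hψc).add ((h3.mul h4).mul (hψ'c.div_const _))
  -- vanishing off `(−L/2, L/2)`
  have hdzero : ∀ u, L / 2 ≤ |u| → d u = 0 := by
    intro u hu
    obtain ⟨h1, h2⟩ := rampProd_eq_zero hr hr0 (L := L) hu
    simp only [hddef]
    rw [h1, h2]; ring
  -- the derivative everywhere
  have hderiv : ∀ u, HasDerivAt (fun v ↦ phi ψ T v ^ 2) (d u) u := by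
    intro u
    have hP := hasDerivAt_rampProd hr L u
    rcases lt_or_ge |u| (L / 2) with hu | hu
    · -- interior: product rule through the inactive clamp
      have hu' : u ∈ Ioo (-(L / 2)) (L / 2) := by rw [abs_lt] at hu; exact ⟨hu.1, hu.2⟩
      have hmem : u / L ∈ J := Ioo_subset_Icc_self (div_mem_Ioo_half' hL0 hu')
      have hQ : HasDerivAt (fun v : ℝ ↦ ψ (clampHalf (v / L))) (derivWithin ψ J (u / L) / L) u :=
        hasDerivAt_comp_clampHalf_div hL0 hu'
          (hasDerivAt_of_differentiableOn_half hdiff (div_mem_Ioo_half' hL0 hu'))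
      have h := hP.mul hQ
      have e : (fun v ↦ phi ψ T v ^ 2) =
          fun v ↦ r (L / 2 + v) * r (L / 2 - v) * ψ (clampHalf (v / L)) := funext hphi2
      rw [e]
      refine h.congr_deriv ?_
      have hc : clampHalf (u / L) = u / L := clampHalf_of_mem hmem
      simp only [hddef, hc]
    · -- boundary and exterior: squeeze `0 ≤ φ² ≤ M·P`, `P(u) = P′(u) = 0`
      obtain ⟨hP0, hP'0⟩ := rampProd_eq_zero hr hr0 (L := L) hu
      rw [hP'0] at hP
      rw [hdzero u hu]
      rw [hasDerivAt_iff_isLittleO] at hP ⊢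
      have hφ0 : phi ψ T u ^ 2 = 0 := phi_sq_eq_zero_of_le_abs (by rwa [← hLdef])
      simp only [smul_zero, sub_zero, hP0] at hP
      simp only [smul_zero, sub_zero, hφ0]
      have hbig : (fun v ↦ phi ψ T v ^ 2) =O[𝓝 u] fun v ↦ r (L / 2 + v) * r (L / 2 - v) := by
        refine IsBigO.of_bound M (Eventually.of_forall fun v ↦ ?_)
        have hPv : 0 ≤ r (L / 2 + v) * r (L / 2 - v) := mul_nonneg (hr01 _).1 (hr01 _).1
        rw [Real.norm_eq_abs, Real.norm_eq_abs, abs_of_nonneg (sq_nonneg _), abs_of_nonneg hPv,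
          hphi2 v, mul_comm M]
        exact mul_le_mul_of_nonneg_left (hM _ (clampHalf_mem _)) hPv
      exact hbig.trans_isLittleO hP
  -- integrability and the `L¹` bound through a majorant
  have hdsupp : ∀ u ∉ Icc (-(L / 2)) (L / 2), d u = 0 := by
    intro u hu
    apply hdzero
    rw [mem_Icc, not_and_or, not_le, not_le] at hu
    rcases hu with hu | hu
    · rw [abs_of_neg (by linarith)]; linarith
    · rw [abs_of_pos (by linarith)]; linarith
  have hdint : Integrable d :=
    hdcont.integrable_of_hasCompactSupport (HasCompactSupport.intro isCompact_Icc hdsupp)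
  set g : ℝ → ℝ := fun u ↦ M * (|deriv r (L / 2 + u)| + |deriv r (L / 2 - u)|) +
    (Icc (-(L / 2)) (L / 2)).indicator (fun _ ↦ B₁ / L) u with hgdef
  have hg1 : Integrable fun u : ℝ ↦ |deriv r (L / 2 + u)| := (hri1.comp_add_left (L / 2)).abs
  have hg2 : Integrable fun u : ℝ ↦ |deriv r (L / 2 - u)| := (hri1.comp_sub_left (L / 2)).abs
  have hg3 : Integrable fun u : ℝ ↦ (Icc (-(L / 2)) (L / 2)).indicator (fun _ ↦ B₁ / L) u :=
    (continuous_const.integrableOn_Icc (a := -(L / 2)) (b := L / 2)).integrable_indicator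
      measurableSet_Icc
  have hg12' : Integrable (fun u : ℝ ↦ |deriv r (L / 2 + u)| + |deriv r (L / 2 - u)|) := by
    exact hg1.add hg2
  have hg12 : Integrable (fun u : ℝ ↦ M * (|deriv r (L / 2 + u)| + |deriv r (L / 2 - u)|)) :=
    hg12'.const_mul M
  have hgint : Integrable g := by rw [hgdef]; exact hg12.add hg3
  have hle : ∀ u, |d u| ≤ g u := by
    intro u
    have hψu : |ψ (clampHalf (u / L))| ≤ M := by
      rw [abs_of_pos (hψ.pos _ (clampHalf_mem _))]; exact hM _ (clampHalf_mem _)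
    have hP' : |deriv r (L / 2 + u) * r (L / 2 - u) - r (L / 2 + u) * deriv r (L / 2 - u)| ≤
        |deriv r (L / 2 + u)| + |deriv r (L / 2 - u)| := by
      refine (abs_sub _ _).trans (add_le_add ?_ ?_)
      · rw [abs_mul]
        calc |deriv r (L / 2 + u)| * |r (L / 2 - u)| ≤ |deriv r (L / 2 + u)| * 1 :=
              mul_le_mul_of_nonneg_left (hrabs _) (abs_nonneg _)
          _ = |deriv r (L / 2 + u)| := mul_one _
      · rw [abs_mul]
        calc |r (L / 2 + u)| * |deriv r (L / 2 - u)| ≤ 1 * |deriv r (L / 2 - u)| :=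
              mul_le_mul_of_nonneg_right (hrabs _) (abs_nonneg _)
          _ = |deriv r (L / 2 - u)| := one_mul _
    have hsecond : |r (L / 2 + u) * r (L / 2 - u) * (derivWithin ψ J (clampHalf (u / L)) / L)| ≤
        (Icc (-(L / 2)) (L / 2)).indicator (fun _ ↦ B₁ / L) u := by
      by_cases hu : u ∈ Icc (-(L / 2)) (L / 2)
      · rw [indicator_of_mem hu, abs_mul, abs_div, abs_of_pos hL0]
        have h1 : |r (L / 2 + u) * r (L / 2 - u)| ≤ 1 := by
          rw [abs_mul]
          calc |r (L / 2 + u)| * |r (L / 2 - u)| ≤ 1 * 1 :=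
                mul_le_mul (hrabs _) (hrabs _) (abs_nonneg _) zero_le_one
            _ = 1 := one_mul 1
        have h2 : |derivWithin ψ J (clampHalf (u / L))| / L ≤ B₁ / L :=
          div_le_div_of_nonneg_right (hB₁ _ (clampHalf_mem _)) hL0.le
        calc |r (L / 2 + u) * r (L / 2 - u)| * (|derivWithin ψ J (clampHalf (u / L))| / L)
            ≤ 1 * (B₁ / L) := mul_le_mul h1 h2 (by positivity) zero_le_one
          _ = B₁ / L := one_mul _
      · rw [indicator_of_notMem hu]
        have hu' : L / 2 ≤ |u| := by
          rw [mem_Icc, not_and_or, not_le, not_le] at hu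
          rcases hu with hu | hu
          · rw [abs_of_neg (by linarith)]; linarith
          · rw [abs_of_pos (by linarith)]; linarith
        rw [(rampProd_eq_zero hr hr0 (L := L) hu').1, zero_mul, abs_zero]
    calc |d u| ≤ |(deriv r (L / 2 + u) * r (L / 2 - u) - r (L / 2 + u) * deriv r (L / 2 - u)) *
          ψ (clampHalf (u / L))| + |r (L / 2 + u) * r (L / 2 - u) *
            (derivWithin ψ J (clampHalf (u / L)) / L)| := abs_add_le _ _
      _ ≤ (|deriv r (L / 2 + u)| + |deriv r (L / 2 - u)|) * M +
          (Icc (-(L / 2)) (L / 2)).indicator (fun _ ↦ B₁ / L) u := by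
          refine add_le_add ?_ hsecond
          rw [abs_mul]
          exact mul_le_mul hP' hψu (abs_nonneg _) (by positivity)
      _ = g u := by simp only [hgdef]; ring
  have hgval : ∫ u, g u = M * (I₁ + I₁) + B₁ / L * L := by
    have e1 : ∫ u : ℝ, |deriv r (L / 2 + u)| = I₁ := integral_add_left_eq_self (fun x ↦ |deriv r x|) (L / 2)
    have e2 : ∫ u : ℝ, |deriv r (L / 2 - u)| = I₁ :=
      integral_sub_left_eq_self (fun x ↦ |deriv r x|) volume (L / 2)
    have e3 : ∫ u : ℝ, (Icc (-(L / 2)) (L / 2)).indicator (fun _ ↦ B₁ / L) u = B₁ / L * L := by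
      rw [integral_indicator measurableSet_Icc, setIntegral_const, Real.volume_real_Icc_of_le (by linarith),
        smul_eq_mul]
      ring
    calc ∫ u, g u = (∫ u : ℝ, M * (|deriv r (L / 2 + u)| + |deriv r (L / 2 - u)|)) +
          ∫ u : ℝ, (Icc (-(L / 2)) (L / 2)).indicator (fun _ ↦ B₁ / L) u := by
          rw [hgdef]; exact integral_add hg12 hg3
      _ = M * ((∫ u : ℝ, |deriv r (L / 2 + u)|) + ∫ u : ℝ, |deriv r (L / 2 - u)|) + B₁ / L * L := by
          rw [integral_const_mul, integral_add hg1 hg2, e3]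
      _ = M * (I₁ + I₁) + B₁ / L * L := by rw [e1, e2]
  refine ⟨d, hdcont, hderiv, hdzero, hdint, ?_⟩
  calc ∫ u, |d u| ≤ ∫ u, g u := integral_mono hdint.abs hgint hle
    _ = M * (I₁ + I₁) + B₁ / L * L := hgval
    _ = 2 * M * I₁ + B₁ := by field_simp; ring

/-! ## §H2. Partial summation of `Σ_n (Λ(n)²/n) φ_T²(log n − u)` against `Σ_{n≤t} Λ(n)²/n = ½log²t + O(log t)`

For fixed `u`, Abel summation (`f(t) = φ_T²(log t − u)`, `f′(t) = (φ_T²)′(log t − u)/t`), the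
substitution `t = e^y` and one integration by parts in `y` give
`Σ_{n≤X} (Λ(n)²/n) φ_T²(log n − u) = ∫_0^L y φ_T²(y − u) dy + O((C L + 1)(M + ‖(φ²)′‖₁))`
uniformly in `u` — the printed "by partial summation with `Σ_{n≤t}Λ(n)²/n = ½log²t + O(log t)`". -/

/-- Substitution `t = e^y`: `∫_{(1,e^L]} H(log t) dt/t = ∫_0^L H(y) dy` for continuous `H`, `L ≥ 0`.
[cite: AlpogeFurman2026, Theorem 5.7 (proof: "by partial summation"), p. 11] -/
theorem setIntegral_comp_log_div {H : ℝ → ℝ} (hH : Continuous H) {L : ℝ} (hL : 0 ≤ L) :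
    ∫ t in Set.Ioc 1 (Real.exp L), H (Real.log t) / t = ∫ y in (0 : ℝ)..L, H y := by
  have hcont : ContinuousOn (fun t : ℝ ↦ H (Real.log t) / t) (Set.Ioi 0) := fun t ht ↦
    ((hH.continuousAt.comp (Real.continuousAt_log (ne_of_gt ht))).div continuousAt_id
      (ne_of_gt ht)).continuousWithinAt
  have himg : Real.exp '' uIcc 0 L ⊆ Set.Ioi 0 := by
    rintro _ ⟨y, -, rfl⟩; exact Real.exp_pos y
  have hsub := intervalIntegral.integral_comp_mul_deriv' (a := 0) (b := L) (f := Real.exp)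
    (f' := Real.exp) (g := fun t : ℝ ↦ H (Real.log t) / t) (fun x _ ↦ Real.hasDerivAt_exp x)
    Real.continuous_exp.continuousOn (hcont.mono himg)
  rw [Real.exp_zero, intervalIntegral.integral_of_le (Real.one_le_exp hL)] at hsub
  rw [← hsub]
  refine intervalIntegral.integral_congr fun y _ ↦ ?_
  simp only [Function.comp_apply, Real.log_exp]
  rw [div_mul_cancel₀ _ (Real.exp_pos y).ne']

/-- **Abel summation** for `c_n = Λ(n)²/n`, `f(t) = φ_T²(log t − u)`:
`Σ_{n≤X} c_n φ_T²(log n − u) = φ_T²(log X − u) A(X) − ∫_1^X (φ_T²)′(log t − u) A(t) dt/t`,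
`A(t) = Σ_{n≤t} Λ(n)²/n` (`X ≥ 1`). [cite: AlpogeFurman2026, Theorem 5.7 (proof: "by partial summation"), p. 11] -/
theorem sum_phi_sq_mul_eq {T : ℝ} {d : ℝ → ℝ} (hdc : Continuous d)
    (hd : ∀ u, HasDerivAt (fun v ↦ phi ψ T v ^ 2) (d u) u) (u X : ℝ) :
    ∑ k ∈ Finset.Icc 0 ⌊X⌋₊, phi ψ T (Real.log k - u) ^ 2 * (Λ k ^ 2 / (k : ℝ)) =
      phi ψ T (Real.log X - u) ^ 2 * ∑ k ∈ Finset.Icc 0 ⌊X⌋₊, Λ k ^ 2 / (k : ℝ) -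
        ∫ t in Set.Ioc 1 X, d (Real.log t - u) / t * ∑ k ∈ Finset.Icc 0 ⌊t⌋₊, Λ k ^ 2 / (k : ℝ) := by
  have hfd : ∀ t : ℝ, 0 < t →
      HasDerivAt (fun s : ℝ ↦ phi ψ T (Real.log s - u) ^ 2) (d (Real.log t - u) / t) t := by
    intro t ht
    have h1 : HasDerivAt (fun s : ℝ ↦ Real.log s - u) t⁻¹ t := (Real.hasDerivAt_log ht.ne').sub_const u
    have h := (hd (Real.log t - u)).comp t h1
    rw [div_eq_mul_inv]
    exact h
  have hdiff : ∀ t ∈ Set.Icc 1 X, DifferentiableAt ℝ (fun s : ℝ ↦ phi ψ T (Real.log s - u) ^ 2) t :=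
    fun t ht ↦ (hfd t (by linarith [ht.1])).differentiableAt
  have hderiv : ∀ t ∈ Set.Icc 1 X,
      deriv (fun s : ℝ ↦ phi ψ T (Real.log s - u) ^ 2) t = d (Real.log t - u) / t :=
    fun t ht ↦ (hfd t (by linarith [ht.1])).deriv
  have hcont : ContinuousOn (fun t : ℝ ↦ d (Real.log t - u) / t) (Set.Icc 1 X) := by
    intro t ht
    have ht0 : t ≠ 0 := by linarith [ht.1]
    exact ((hdc.continuousAt.comp ((Real.continuousAt_log ht0).sub continuousAt_const)).div
      continuousAt_id ht0).continuousWithinAt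
  have hint : IntegrableOn (deriv fun s : ℝ ↦ phi ψ T (Real.log s - u) ^ 2) (Set.Icc 1 X) :=
    (hcont.integrableOn_Icc).congr_fun (fun t ht ↦ (hderiv t ht).symm) measurableSet_Icc
  have habel := sum_mul_eq_sub_integral_mul₀ (fun k ↦ Λ k ^ 2 / (k : ℝ)) (by simp) X hdiff hint
  rw [habel]
  congr 1
  refine setIntegral_congr_fun measurableSet_Ioc fun t ht ↦ ?_
  rw [hderiv t ⟨ht.1.le, ht.2⟩]

/-- The main-term integral after `t = e^y` and one integration by parts:
`∫_1^{e^L} (φ_T²)′(log t − u) (log²t/2) dt/t = φ_T²(L − u) L²/2 − ∫_0^L y φ_T²(y − u) dy`.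
[cite: AlpogeFurman2026, Theorem 5.7 (proof: "by partial summation"), p. 11] -/
theorem integral_deriv_log_sq (hψ : IsWindow ψ) {T : ℝ} {d : ℝ → ℝ} (hdc : Continuous d)
    (hd : ∀ u, HasDerivAt (fun v ↦ phi ψ T v ^ 2) (d u) u) (u : ℝ) {L : ℝ} (hL : 0 ≤ L) :
    ∫ t in Set.Ioc 1 (Real.exp L), d (Real.log t - u) / t * (Real.log t ^ 2 / 2) =
      phi ψ T (L - u) ^ 2 * (L ^ 2 / 2) - ∫ y in (0 : ℝ)..L, phi ψ T (y - u) ^ 2 * y := by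
  have h1 : ∫ t in Set.Ioc 1 (Real.exp L), d (Real.log t - u) / t * (Real.log t ^ 2 / 2) =
      ∫ y in (0 : ℝ)..L, d (y - u) * (y ^ 2 / 2) := by
    rw [← setIntegral_comp_log_div (H := fun s ↦ d (s - u) * (s ^ 2 / 2)) (by fun_prop) hL]
    refine setIntegral_congr_fun measurableSet_Ioc fun t _ ↦ ?_
    ring
  rw [h1]
  have hu' : ∀ y ∈ uIcc 0 L, HasDerivAt (fun y : ℝ ↦ phi ψ T (y - u) ^ 2) (d (y - u)) y :=
    fun y _ ↦ HasDerivAt.comp_sub_const y u (hd (y - u))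
  have hv' : ∀ y ∈ uIcc 0 L, HasDerivAt (fun y : ℝ ↦ y ^ 2 / 2) y y := by
    intro y _
    have h := (hasDerivAt_pow 2 y).div_const 2
    refine h.congr_deriv ?_
    push_cast
    ring
  have hiu : IntervalIntegrable (fun y : ℝ ↦ d (y - u)) volume 0 L :=
    (hdc.comp (continuous_id.sub continuous_const)).intervalIntegrable _ _
  have hiv : IntervalIntegrable (fun y : ℝ ↦ y) volume 0 L := continuous_id.intervalIntegrable _ _
  have hparts := intervalIntegral.integral_mul_deriv_eq_deriv_mul hu' hv' hiu hiv
  rw [hparts]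
  have hφc : Continuous fun y : ℝ ↦ phi ψ T (y - u) ^ 2 :=
    (hψ.continuous_phi_sq T).comp (continuous_id.sub continuous_const)
  have e : ∫ y in (0 : ℝ)..L, d (y - u) * (y ^ 2 / 2) = ∫ y in (0 : ℝ)..L, d (y - u) * (fun y : ℝ ↦ y ^ 2 / 2) y :=
    rfl
  simp only [zero_sub]
  ring

/-- For all `u`: `|Σ_{n≤X} (Λ(n)²/n) φ_T²(log n − u) − ∫_0^L y φ_T²(y − u) dy| ≤ (CL + 1)(M + K)`
(`X = e^L = T/2π`, `L ≥ 1`; `ψ ≤ M`, `∫|(φ_T²)′| ≤ K`, `|Σ_{n≤t}Λ(n)²/n − ½log²t| ≤ C log t + 1` for `t ≥ 1`).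
[cite: AlpogeFurman2026, Theorem 5.7 (proof: "by partial summation with `Σ_{n≤t}Λ(n)²/n = ½log²t + O(log t)`"), p. 11] -/
theorem abs_sum_phi_sq_sub_integral_le (hψ : IsWindow ψ) {T : ℝ} (hL1 : 1 ≤ logHeight T)
    {d : ℝ → ℝ} (hdc : Continuous d) (hd : ∀ u, HasDerivAt (fun v ↦ phi ψ T v ^ 2) (d u) u)
    (hdint : Integrable d) {K : ℝ} (hdK : ∫ u, |d u| ≤ K)
    {M : ℝ} (hM : ∀ x ∈ Icc (-(1 / 2 : ℝ)) (1 / 2), ψ x ≤ M) {C : ℝ} (hC : 0 ≤ C)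
    (hE : ∀ t : ℝ, 1 ≤ t →
      |∑ k ∈ Finset.Icc 0 ⌊t⌋₊, Λ k ^ 2 / (k : ℝ) - Real.log t ^ 2 / 2| ≤ C * Real.log t + 1)
    (u : ℝ) :
    |∑ k ∈ Finset.Icc 0 ⌊Real.exp (logHeight T)⌋₊, phi ψ T (Real.log k - u) ^ 2 * (Λ k ^ 2 / (k : ℝ)) -
        ∫ y in (0 : ℝ)..logHeight T, phi ψ T (y - u) ^ 2 * y| ≤
      (C * logHeight T + 1) * (M + K) := by
  set L := logHeight T with hLdef
  set X := Real.exp L with hXdef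
  have hL0 : 0 ≤ L := by linarith
  have hX1 : 1 ≤ X := Real.one_le_exp hL0
  have hlogX : Real.log X = L := Real.log_exp L
  have hM0 : 0 ≤ M := (hψ.pos 0 (by norm_num)).le.trans (hM 0 (by norm_num))
  have hK0 : 0 ≤ K := (integral_nonneg fun u ↦ abs_nonneg _).trans hdK
  set A : ℝ → ℝ := fun t ↦ ∑ k ∈ Finset.Icc 0 ⌊t⌋₊, Λ k ^ 2 / (k : ℝ) with hAdef
  -- Abel
  have habel := sum_phi_sq_mul_eq (ψ := ψ) hdc hd u X
  rw [hlogX] at habel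
  -- the two pieces of `∫ f′ A`
  have hcontF : ContinuousOn (fun t : ℝ ↦ d (Real.log t - u) / t) (Set.Icc 1 X) := by
    intro t ht
    have ht0 : t ≠ 0 := by linarith [ht.1]
    exact ((hdc.continuousAt.comp ((Real.continuousAt_log ht0).sub continuousAt_const)).div
      continuousAt_id ht0).continuousWithinAt
  have hFA : IntegrableOn (fun t : ℝ ↦ d (Real.log t - u) / t * A t) (Set.Ioc 1 X) :=
    (integrableOn_mul_sum_Icc (fun k ↦ Λ k ^ 2 / (k : ℝ)) zero_le_one hcontF.integrableOn_Icc).mono_set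
      Set.Ioc_subset_Icc_self
  have hcontG : ContinuousOn (fun t : ℝ ↦ d (Real.log t - u) / t * (Real.log t ^ 2 / 2)) (Set.Icc 1 X) := by
    refine hcontF.mul ((ContinuousOn.pow (Real.continuousOn_log.mono ?_) 2).div_const 2)
    intro t ht
    simp only [Set.mem_compl_iff, Set.mem_singleton_iff]
    linarith [ht.1]
  have hFG : IntegrableOn (fun t : ℝ ↦ d (Real.log t - u) / t * (Real.log t ^ 2 / 2)) (Set.Ioc 1 X) :=
    hcontG.integrableOn_Icc.mono_set Set.Ioc_subset_Icc_self
  have hFE : IntegrableOn (fun t : ℝ ↦ d (Real.log t - u) / t * (A t - Real.log t ^ 2 / 2)) (Set.Ioc 1 X) :=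
    (hFA.sub hFG).congr_fun (fun t _ ↦ by simp only [Pi.sub_apply]; ring) measurableSet_Ioc
  have hsplit : ∫ t in Set.Ioc 1 X, d (Real.log t - u) / t * A t =
      (∫ t in Set.Ioc 1 X, d (Real.log t - u) / t * (Real.log t ^ 2 / 2)) +
        ∫ t in Set.Ioc 1 X, d (Real.log t - u) / t * (A t - Real.log t ^ 2 / 2) := by
    rw [← integral_add hFG hFE]
    refine setIntegral_congr_fun measurableSet_Ioc fun t _ ↦ ?_
    ring
  have hmain := integral_deriv_log_sq hψ hdc hd u hL0
  -- the error piece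
  have hcontAbs : ContinuousOn (fun t : ℝ ↦ |d (Real.log t - u)| / t) (Set.Icc 1 X) := by
    intro t ht
    have ht0 : t ≠ 0 := by linarith [ht.1]
    exact (((continuous_abs.comp hdc).continuousAt.comp
      ((Real.continuousAt_log ht0).sub continuousAt_const)).div continuousAt_id ht0).continuousWithinAt
  have herrInt : IntegrableOn (fun t : ℝ ↦ (C * L + 1) * (|d (Real.log t - u)| / t)) (Set.Ioc 1 X) :=
    (hcontAbs.integrableOn_Icc.mono_set Set.Ioc_subset_Icc_self).const_mul _
  have herr : |∫ t in Set.Ioc 1 X, d (Real.log t - u) / t * (A t - Real.log t ^ 2 / 2)| ≤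
      (C * L + 1) * K := by
    have h1 : ‖∫ t in Set.Ioc 1 X, d (Real.log t - u) / t * (A t - Real.log t ^ 2 / 2)‖ ≤
        ∫ t in Set.Ioc 1 X, (C * L + 1) * (|d (Real.log t - u)| / t) := by
      refine norm_integral_le_of_norm_le herrInt ?_
      rw [ae_restrict_iff' measurableSet_Ioc]
      refine Eventually.of_forall fun t ht ↦ ?_
      have ht1 : 1 ≤ t := ht.1.le
      have ht0 : 0 < t := by linarith
      have hlogt : Real.log t ≤ L := by
        rw [← hlogX]; exact Real.log_le_log ht0 ht.2
      have hlogt0 : 0 ≤ Real.log t := Real.log_nonneg ht1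
      have hEt := hE t ht1
      rw [Real.norm_eq_abs, abs_mul, abs_div, abs_of_pos ht0]
      calc |d (Real.log t - u)| / t * |A t - Real.log t ^ 2 / 2|
          ≤ |d (Real.log t - u)| / t * (C * L + 1) := by
            refine mul_le_mul_of_nonneg_left (hEt.trans ?_) (by positivity)
            nlinarith
        _ = (C * L + 1) * (|d (Real.log t - u)| / t) := by ring
    have h2 : ∫ t in Set.Ioc 1 X, (C * L + 1) * (|d (Real.log t - u)| / t) ≤ (C * L + 1) * K := by
      rw [integral_const_mul]
      refine mul_le_mul_of_nonneg_left ?_ (by positivity)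
      rw [hXdef, setIntegral_comp_log_div (H := fun s ↦ |d (s - u)|) (continuous_abs.comp
        (hdc.comp (continuous_id.sub continuous_const))) hL0,
        intervalIntegral.integral_of_le hL0]
      calc ∫ y in Set.Ioc 0 L, |d (y - u)| ≤ ∫ y, |d (y - u)| :=
            setIntegral_le_integral ((hdint.comp_sub_right u).abs) (Eventually.of_forall fun y ↦ abs_nonneg _)
        _ = ∫ y, |d y| := integral_sub_right_eq_self (fun y ↦ |d y|) u
        _ ≤ K := hdK
    rw [← Real.norm_eq_abs]
    exact h1.trans h2
  -- the boundary piece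
  have hbd : |phi ψ T (L - u) ^ 2 * (A X - L ^ 2 / 2)| ≤ M * (C * L + 1) := by
    rw [abs_mul, abs_of_nonneg (sq_nonneg _)]
    have h := hE X hX1
    rw [hlogX] at h
    exact mul_le_mul (phi_sq_le hψ hM T _) h (abs_nonneg _) hM0
  -- assemble
  have key : ∑ k ∈ Finset.Icc 0 ⌊X⌋₊, phi ψ T (Real.log k - u) ^ 2 * (Λ k ^ 2 / (k : ℝ)) -
      ∫ y in (0 : ℝ)..L, phi ψ T (y - u) ^ 2 * y =
      phi ψ T (L - u) ^ 2 * (A X - L ^ 2 / 2) -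
        ∫ t in Set.Ioc 1 X, d (Real.log t - u) / t * (A t - Real.log t ^ 2 / 2) := by
    rw [habel, hsplit, hXdef, hmain]
    ring
  rw [key]
  calc |phi ψ T (L - u) ^ 2 * (A X - L ^ 2 / 2) -
        ∫ t in Set.Ioc 1 X, d (Real.log t - u) / t * (A t - Real.log t ^ 2 / 2)|
      ≤ |phi ψ T (L - u) ^ 2 * (A X - L ^ 2 / 2)| +
        |∫ t in Set.Ioc 1 X, d (Real.log t - u) / t * (A t - Real.log t ^ 2 / 2)| := abs_sub _ _
    _ ≤ M * (C * L + 1) + (C * L + 1) * K := add_le_add hbd herr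
    _ = (C * L + 1) * (M + K) := by ring


/-! ## §H3. `Σ_n (Λ(n)²/n) g(log n) = ∫ φ_T²(v) Σ_n (Λ(n)²/n) φ_T²(log n − v) dv` and its evaluation -/

/-- `Σ_{n≤X} (Λ(n)²/n) g(log n) = ∫ φ_T²(v) [Σ_{n≤X} (Λ(n)²/n) φ_T²(log n − v)] dv` (`g = φ² ⋆ φ²`; a
finite sum through the integral). [cite: AlpogeFurman2026, Theorem 5.7 (proof), p. 11] -/
theorem sum_gConv_eq_integral (hψ : IsWindow ψ) (T X : ℝ) :
    ∑ k ∈ Finset.Icc 0 ⌊X⌋₊, gConv ψ T (Real.log k) * (Λ k ^ 2 / (k : ℝ)) =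
      ∫ v, phi ψ T v ^ 2 *
        ∑ k ∈ Finset.Icc 0 ⌊X⌋₊, phi ψ T (Real.log k - v) ^ 2 * (Λ k ^ 2 / (k : ℝ)) := by
  have hint : ∀ k ∈ Finset.Icc 0 ⌊X⌋₊, Integrable fun v : ℝ ↦
      phi ψ T v ^ 2 * (phi ψ T (Real.log k - v) ^ 2 * (Λ k ^ 2 / (k : ℝ))) := by
    intro k _
    have hK : HasCompactSupport fun v : ℝ ↦
        phi ψ T v ^ 2 * (phi ψ T (Real.log k - v) ^ 2 * (Λ k ^ 2 / (k : ℝ))) :=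
      (hasCompactSupport_phi_sq ψ T).mul_right
        (f' := fun v : ℝ ↦ phi ψ T (Real.log k - v) ^ 2 * (Λ k ^ 2 / (k : ℝ)))
    refine Continuous.integrable_of_hasCompactSupport ?_ hK
    exact (hψ.continuous_phi_sq T).mul
      (((hψ.continuous_phi_sq T).comp (continuous_const.sub continuous_id)).mul continuous_const)
  simp_rw [Finset.mul_sum]
  rw [integral_finsetSum _ hint]
  refine Finset.sum_congr rfl fun k _ ↦ ?_
  rw [gConv, ← integral_mul_const]
  refine integral_congr_ae (Eventually.of_forall fun v ↦ ?_)
  ring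

/-- `v ↦ ∫_0^L y φ_T²(y − v) dy` is continuous. [cite: AlpogeFurman2026, Theorem 5.7 (proof), p. 11] -/
theorem continuous_moment (hψ : IsWindow ψ) (T L : ℝ) :
    Continuous fun v : ℝ ↦ ∫ y in (0 : ℝ)..L, phi ψ T (y - v) ^ 2 * y := by
  have h : Continuous (Function.uncurry fun (v y : ℝ) ↦ phi ψ T (y - v) ^ 2 * y) :=
    ((hψ.continuous_phi_sq T).comp (continuous_snd.sub continuous_fst)).mul continuous_snd
  exact intervalIntegral.continuous_parametric_intervalIntegral_of_continuous' (μ := volume) h 0 L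

/-- **`|Σ_{n≤X} (Λ(n)²/n) g(log n) − ∫ φ_T²(v) (∫_0^L y φ_T²(y − v) dy) dv| ≤ (CL+1)(M+K) ∫φ_T²`**
(`X = e^L`, `L ≥ 1`). [cite: AlpogeFurman2026, Theorem 5.7 (proof: "`Σ_{n≤X}(Λ(n)²/n)g(log n) = … + O_χ(L²)`"), p. 11] -/
theorem abs_sum_gConv_sub_le (hψ : IsWindow ψ) {T : ℝ} (hL1 : 1 ≤ logHeight T)
    {d : ℝ → ℝ} (hdc : Continuous d) (hd : ∀ u, HasDerivAt (fun v ↦ phi ψ T v ^ 2) (d u) u)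
    (hdint : Integrable d) {K : ℝ} (hdK : ∫ u, |d u| ≤ K)
    {M : ℝ} (hM : ∀ x ∈ Icc (-(1 / 2 : ℝ)) (1 / 2), ψ x ≤ M) {C : ℝ} (hC : 0 ≤ C)
    (hE : ∀ t : ℝ, 1 ≤ t →
      |∑ k ∈ Finset.Icc 0 ⌊t⌋₊, Λ k ^ 2 / (k : ℝ) - Real.log t ^ 2 / 2| ≤ C * Real.log t + 1) :
    |∑ k ∈ Finset.Icc 0 ⌊Real.exp (logHeight T)⌋₊, gConv ψ T (Real.log k) * (Λ k ^ 2 / (k : ℝ)) -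
        ∫ v, phi ψ T v ^ 2 * ∫ y in (0 : ℝ)..logHeight T, phi ψ T (y - v) ^ 2 * y| ≤
      (C * logHeight T + 1) * (M + K) * ∫ v, phi ψ T v ^ 2 := by
  set L := logHeight T with hLdef
  set X := Real.exp L with hXdef
  rw [sum_gConv_eq_integral hψ T X]
  set S : ℝ → ℝ := fun v ↦
    ∑ k ∈ Finset.Icc 0 ⌊X⌋₊, phi ψ T (Real.log k - v) ^ 2 * (Λ k ^ 2 / (k : ℝ)) with hSdef
  set m : ℝ → ℝ := fun v ↦ ∫ y in (0 : ℝ)..L, phi ψ T (y - v) ^ 2 * y with hmdef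
  have hS : ∀ v, |S v - m v| ≤ (C * L + 1) * (M + K) := fun v ↦
    abs_sum_phi_sq_sub_integral_le hψ hL1 hdc hd hdint hdK hM hC hE v
  have hSc : Continuous S := by
    refine continuous_finsetSum _ fun k _ ↦ ?_
    exact ((hψ.continuous_phi_sq T).comp (continuous_const.sub continuous_id)).mul continuous_const
  have hmc : Continuous m := continuous_moment hψ T L
  have hφS : Integrable fun v : ℝ ↦ phi ψ T v ^ 2 * S v :=
    ((hψ.continuous_phi_sq T).mul hSc).integrable_of_hasCompactSupport
      ((hasCompactSupport_phi_sq ψ T).mul_right (f' := S))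
  have hφm : Integrable fun v : ℝ ↦ phi ψ T v ^ 2 * m v :=
    ((hψ.continuous_phi_sq T).mul hmc).integrable_of_hasCompactSupport
      ((hasCompactSupport_phi_sq ψ T).mul_right (f' := m))
  rw [← integral_sub hφS hφm]
  have hbound : ∀ v, ‖phi ψ T v ^ 2 * S v - phi ψ T v ^ 2 * m v‖ ≤
      (C * L + 1) * (M + K) * phi ψ T v ^ 2 := by
    intro v
    rw [← mul_sub, Real.norm_eq_abs, abs_mul, abs_of_nonneg (sq_nonneg _), mul_comm]
    exact mul_le_mul_of_nonneg_right (hS v) (sq_nonneg _)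
  rw [← Real.norm_eq_abs]
  calc ‖∫ v, (phi ψ T v ^ 2 * S v - phi ψ T v ^ 2 * m v)‖
      ≤ ∫ v, (C * L + 1) * (M + K) * phi ψ T v ^ 2 :=
        norm_integral_le_of_norm_le (((hψ.integrable_phi_sq T)).const_mul _) (Eventually.of_forall hbound)
    _ = (C * L + 1) * (M + K) * ∫ v, phi ψ T v ^ 2 := integral_const_mul _ _

/-! ## §H4. `∫ φ_T²(v) (∫_0^L y φ_T²(y−v) dy) dv = ½∬|v+x|φ_T²φ_T² = (L³/2)∬|s−t|ψψ + O(L²)` -/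

/-- `∫_0^L y φ_T²(y − v) dy = ∫_{−v}^{L/2} |v + x| φ_T²(x) dx` for `|v| ≤ L/2` (shift `y = v + x`, support).
[cite: AlpogeFurman2026, Theorem 5.7 (proof: "`2∫_0^1 w(ψ∗ψ) = ∬|u−v|ψψ`"), p. 11] -/
theorem moment_eq_right (hψ : IsWindow ψ) {T v : ℝ} (hv : |v| ≤ logHeight T / 2) :
    ∫ y in (0 : ℝ)..logHeight T, phi ψ T (y - v) ^ 2 * y =
      ∫ x in (-v)..(logHeight T / 2), |v + x| * phi ψ T x ^ 2 := by
  set L := logHeight T with hLdef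
  have hv' := abs_le.1 hv
  have hc : Continuous fun x : ℝ ↦ phi ψ T x ^ 2 * (x + v) := (hψ.continuous_phi_sq T).mul (by fun_prop)
  have hi : ∀ a b : ℝ, IntervalIntegrable (fun x : ℝ ↦ phi ψ T x ^ 2 * (x + v)) volume a b :=
    fun a b ↦ hc.intervalIntegrable _ _
  have h1 : ∫ y in (0 : ℝ)..L, phi ψ T (y - v) ^ 2 * y = ∫ x in (0 - v)..(L - v), phi ψ T x ^ 2 * (x + v) := by
    rw [← intervalIntegral.integral_comp_sub_right (fun x : ℝ ↦ phi ψ T x ^ 2 * (x + v)) v]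
    refine intervalIntegral.integral_congr fun y _ ↦ ?_
    simp only [sub_add_cancel]
  rw [h1, zero_sub, ← intervalIntegral.integral_add_adjacent_intervals (hi (-v) (L / 2)) (hi (L / 2) (L - v))]
  have h2 : ∫ x in (L / 2)..(L - v), phi ψ T x ^ 2 * (x + v) = 0 := by
    rw [intervalIntegral.integral_congr (g := fun _ ↦ (0 : ℝ)) fun x hx ↦ ?_, intervalIntegral.integral_zero]
    rw [uIcc_of_le (by linarith)] at hx
    show phi ψ T x ^ 2 * (x + v) = 0
    rw [phi_sq_eq_zero_of_le_abs (by rw [← hLdef]; exact hx.1.trans (le_abs_self x)), zero_mul]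
  rw [h2, add_zero]
  refine intervalIntegral.integral_congr fun x hx ↦ ?_
  rw [uIcc_of_le (by linarith)] at hx
  show phi ψ T x ^ 2 * (x + v) = |v + x| * phi ψ T x ^ 2
  rw [abs_of_nonneg (by linarith [hx.1])]
  ring

/-- `∫_0^L y φ_T²(y + v) dy = ∫_{−L/2}^{−v} |v + x| φ_T²(x) dx` for `|v| ≤ L/2` (shift, support, reflection,
evenness). [cite: AlpogeFurman2026, Theorem 5.7 (proof: "`2∫_0^1 w(ψ∗ψ) = ∬|u−v|ψψ`, `ψ` even"), p. 11] -/
theorem moment_eq_left (hψ : IsWindow ψ) {T v : ℝ} (hv : |v| ≤ logHeight T / 2) :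
    ∫ y in (0 : ℝ)..logHeight T, phi ψ T (y + v) ^ 2 * y =
      ∫ x in (-(logHeight T / 2))..(-v), |v + x| * phi ψ T x ^ 2 := by
  set L := logHeight T with hLdef
  have hv' := abs_le.1 hv
  have hc : Continuous fun x : ℝ ↦ phi ψ T x ^ 2 * (x - v) := (hψ.continuous_phi_sq T).mul (by fun_prop)
  have hi : ∀ a b : ℝ, IntervalIntegrable (fun x : ℝ ↦ phi ψ T x ^ 2 * (x - v)) volume a b :=
    fun a b ↦ hc.intervalIntegrable _ _
  have h1 : ∫ y in (0 : ℝ)..L, phi ψ T (y + v) ^ 2 * y = ∫ x in (0 + v)..(L + v), phi ψ T x ^ 2 * (x - v) := by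
    rw [← intervalIntegral.integral_comp_add_right (fun x : ℝ ↦ phi ψ T x ^ 2 * (x - v)) v]
    refine intervalIntegral.integral_congr fun y _ ↦ ?_
    simp only [add_sub_cancel_right]
  rw [h1, zero_add, ← intervalIntegral.integral_add_adjacent_intervals (hi v (L / 2)) (hi (L / 2) (L + v))]
  have h2 : ∫ x in (L / 2)..(L + v), phi ψ T x ^ 2 * (x - v) = 0 := by
    rw [intervalIntegral.integral_congr (g := fun _ ↦ (0 : ℝ)) fun x hx ↦ ?_, intervalIntegral.integral_zero]
    rw [uIcc_of_le (by linarith)] at hx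
    show phi ψ T x ^ 2 * (x - v) = 0
    rw [phi_sq_eq_zero_of_le_abs (by rw [← hLdef]; exact hx.1.trans (le_abs_self x)), zero_mul]
  rw [h2, add_zero]
  have h3 : ∫ x in (-(L / 2))..(-v), (fun x : ℝ ↦ phi ψ T x ^ 2 * (x - v)) (-x) =
      ∫ x in v..(L / 2), phi ψ T x ^ 2 * (x - v) := by
    rw [intervalIntegral.integral_comp_neg (fun x : ℝ ↦ phi ψ T x ^ 2 * (x - v))]
    simp only [neg_neg]
  rw [← h3]
  refine intervalIntegral.integral_congr fun x hx ↦ ?_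
  rw [uIcc_of_le (by linarith)] at hx
  show phi ψ T (-x) ^ 2 * (-x - v) = |v + x| * phi ψ T x ^ 2
  rw [phi_neg hψ.even, abs_of_nonpos (by linarith [hx.2])]
  ring

/-- **`∫ φ_T²(v) (∫_0^L y φ_T²(y−v) dy) dv = ½ ∫ φ_T²(v) ∫_{−L/2}^{L/2} |v+x| φ_T²(x) dx dv`** (`L > 0`;
reflection `v ↦ −v` in the outer integral and the two half-identities above).
[cite: AlpogeFurman2026, Theorem 5.7 (proof: "`2∫_0^1 w(ψ∗ψ) = ∬|u−v|ψψ`"), p. 11] -/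
theorem integral_moment_eq_half (hψ : IsWindow ψ) (T : ℝ) :
    ∫ v, phi ψ T v ^ 2 * ∫ y in (0 : ℝ)..logHeight T, phi ψ T (y - v) ^ 2 * y =
      1 / 2 * ∫ v, phi ψ T v ^ 2 *
        ∫ x in (-(logHeight T / 2))..(logHeight T / 2), |v + x| * phi ψ T x ^ 2 := by
  set L := logHeight T with hLdef
  set m : ℝ → ℝ := fun v ↦ ∫ y in (0 : ℝ)..L, phi ψ T (y - v) ^ 2 * y with hmdef
  have hmc : Continuous m := continuous_moment hψ T L
  have hmc' : Continuous fun v ↦ m (-v) := hmc.comp continuous_neg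
  have hφm : Integrable fun v : ℝ ↦ phi ψ T v ^ 2 * m v :=
    ((hψ.continuous_phi_sq T).mul hmc).integrable_of_hasCompactSupport
      ((hasCompactSupport_phi_sq ψ T).mul_right (f' := m))
  have hφm' : Integrable fun v : ℝ ↦ phi ψ T v ^ 2 * m (-v) :=
    ((hψ.continuous_phi_sq T).mul hmc').integrable_of_hasCompactSupport
      ((hasCompactSupport_phi_sq ψ T).mul_right (f' := fun v ↦ m (-v)))
  have hrefl : ∫ v, phi ψ T v ^ 2 * m v = ∫ v, phi ψ T v ^ 2 * m (-v) := by
    rw [← integral_neg_eq_self (fun v ↦ phi ψ T v ^ 2 * m v)]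
    refine integral_congr_ae (Eventually.of_forall fun v ↦ ?_)
    show phi ψ T (-v) ^ 2 * m (-v) = phi ψ T v ^ 2 * m (-v)
    rw [phi_neg hψ.even]
  have hsum : ∫ v, phi ψ T v ^ 2 * m v = 1 / 2 * ∫ v, phi ψ T v ^ 2 * (m v + m (-v)) := by
    have e : ∫ v, phi ψ T v ^ 2 * (m v + m (-v)) =
        (∫ v, phi ψ T v ^ 2 * m v) + ∫ v, phi ψ T v ^ 2 * m (-v) := by
      rw [← integral_add hφm hφm']
      refine integral_congr_ae (Eventually.of_forall fun v ↦ ?_)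
      show phi ψ T v ^ 2 * (m v + m (-v)) = phi ψ T v ^ 2 * m v + phi ψ T v ^ 2 * m (-v)
      ring
    rw [e, ← hrefl]
    ring
  show ∫ v, phi ψ T v ^ 2 * m v = _
  rw [hsum]
  congr 1
  refine integral_congr_ae (Eventually.of_forall fun v ↦ ?_)
  show phi ψ T v ^ 2 * (m v + m (-v)) = phi ψ T v ^ 2 * ∫ x in (-(L / 2))..(L / 2), |v + x| * phi ψ T x ^ 2
  rcases le_or_gt |v| (L / 2) with hv | hv
  · have hv' := abs_le.1 hv
    have hc : Continuous fun x : ℝ ↦ |v + x| * phi ψ T x ^ 2 := by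
      exact (continuous_abs.comp (continuous_const.add continuous_id)).mul (hψ.continuous_phi_sq T)
    have h1 : m v = ∫ x in (-v)..(L / 2), |v + x| * phi ψ T x ^ 2 := moment_eq_right hψ (by rwa [← hLdef])
    have h2 : m (-v) = ∫ x in (-(L / 2))..(-v), |v + x| * phi ψ T x ^ 2 := by
      have h := moment_eq_left hψ (T := T) (v := v) (by rwa [← hLdef])
      rw [← hLdef] at h
      rw [← h]
      show (∫ y in (0 : ℝ)..L, phi ψ T (y - -v) ^ 2 * y) = _
      simp only [sub_neg_eq_add]
    rw [h1, h2, add_comm, intervalIntegral.integral_add_adjacent_intervals (hc.intervalIntegrable _ _)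
      (hc.intervalIntegrable _ _)]
  · rw [phi_sq_eq_zero_of_le_abs (by rw [← hLdef]; exact hv.le), zero_mul, zero_mul]

/-- `∫_{−L/2}^{L/2} |φ_T² − ψ(clamp(·/L))| ≤ 2M` (`L ≥ 2`, `ψ ≤ M`): the two agree on the bulk
`|u| ≤ L/2 − 1` and differ by at most `M` on the two unit transition intervals.
[cite: AlpogeFurman2026, Theorem 5.7 (proof: "`φ²(u) = ψ(u/L) + O(𝟙_{|u|>L/2−1})`"), p. 11] -/
theorem integral_abs_phi_sq_sub_clamp_le (hψ : IsWindow ψ) {M : ℝ}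
    (hM : ∀ x ∈ Icc (-(1 / 2 : ℝ)) (1 / 2), ψ x ≤ M) {T : ℝ} (hL : 2 ≤ logHeight T) :
    ∫ u in (-(logHeight T / 2))..(logHeight T / 2),
        |phi ψ T u ^ 2 - ψ (clampHalf (u / logHeight T))| ≤ 2 * M := by
  set L := logHeight T with hLdef
  have hL0 : 0 < L := by linarith
  set F : ℝ → ℝ := fun u ↦ |phi ψ T u ^ 2 - ψ (clampHalf (u / L))| with hFdef
  have hFc : Continuous F :=
    continuous_abs.comp ((hψ.continuous_phi_sq T).sub (hψ.continuous_clamp L))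
  have hi : ∀ a b : ℝ, IntervalIntegrable F volume a b := fun a b ↦ hFc.intervalIntegrable _ _
  have hpt : ∀ u, F u ≤ M := by
    intro u
    have h0 : 0 ≤ phi ψ T u ^ 2 := sq_nonneg _
    have h1 : phi ψ T u ^ 2 ≤ ψ (clampHalf (u / L)) := phi_sq_le_clamp hψ T u
    have h2 : ψ (clampHalf (u / L)) ≤ M := hM _ (clampHalf_mem _)
    show |phi ψ T u ^ 2 - ψ (clampHalf (u / L))| ≤ M
    rw [abs_sub_comm, abs_of_nonneg (by linarith)]
    linarith
  have hbulk : ∀ u ∈ uIcc (-(L / 2) + 1) (L / 2 - 1), F u = (fun _ ↦ (0 : ℝ)) u := by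
    intro u hu
    rw [uIcc_of_le (by linarith)] at hu
    have hu' : |u| ≤ L / 2 - 1 := abs_le.2 ⟨by linarith [hu.1], hu.2⟩
    have hmem : u / L ∈ Icc (-(1 / 2 : ℝ)) (1 / 2) := by
      have h := abs_le.1 hu'
      constructor
      · rw [le_div_iff₀ hL0]; linarith
      · rw [div_le_iff₀ hL0]; linarith
    show |phi ψ T u ^ 2 - ψ (clampHalf (u / L))| = 0
    rw [phi_sq_eq_of_abs_le hψ hL0 hu', clampHalf_of_mem hmem, sub_self, abs_zero]
  have hsplit : ∫ u in (-(L / 2))..(L / 2), F u = (∫ u in (-(L / 2))..(-(L / 2) + 1), F u) +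
      ((∫ u in (-(L / 2) + 1)..(L / 2 - 1), F u) + ∫ u in (L / 2 - 1)..(L / 2), F u) := by
    rw [intervalIntegral.integral_add_adjacent_intervals (hi _ _) (hi _ _),
      intervalIntegral.integral_add_adjacent_intervals (hi _ _) (hi _ _)]
  have hmid : ∫ u in (-(L / 2) + 1)..(L / 2 - 1), F u = 0 := by
    rw [intervalIntegral.integral_congr hbulk, intervalIntegral.integral_zero]
  have hend : ∀ a : ℝ, ∫ u in a..(a + 1), F u ≤ M := by
    intro a
    have h := intervalIntegral.integral_mono_on (by linarith : a ≤ a + 1) (hi a (a + 1))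
      (continuous_const.intervalIntegrable a (a + 1)) (fun u _ ↦ hpt u)
    rw [intervalIntegral.integral_const, smul_eq_mul] at h
    linarith [show (a + 1 - a) * M = M by ring]
  have h1 := hend (-(L / 2))
  have h2 := hend (L / 2 - 1)
  rw [show L / 2 - 1 + 1 = L / 2 by ring] at h2
  show ∫ u in (-(L / 2))..(L / 2), F u ≤ 2 * M
  rw [hsplit, hmid, zero_add]
  linarith

/-- `v ↦ ∫_{−L/2}^{L/2} |v + x| F(x) dx` is continuous for continuous `F`. [cite: AlpogeFurman2026, Theorem 5.7 (proof), p. 11] -/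
theorem continuous_absWeight {F : ℝ → ℝ} (hF : Continuous F) (L : ℝ) :
    Continuous fun v : ℝ ↦ ∫ x in (-(L / 2))..(L / 2), |v + x| * F x := by
  have h : Continuous (Function.uncurry fun (v x : ℝ) ↦ |v + x| * F x) :=
    (continuous_abs.comp (continuous_fst.add continuous_snd)).mul (hF.comp continuous_snd)
  exact intervalIntegral.continuous_parametric_intervalIntegral_of_continuous' (μ := volume) h _ _

/-- **Rescaling `φ_T² ↦ ψ(·/L)` in the double integral**: with the weight `|v + x| ≤ L` on `[−L/2,L/2]²`,
`|∫ φ_T²(v) ∫ |v+x| φ_T²(x) − ∫_{−L/2}^{L/2} ψ(v/L) ∫_{−L/2}^{L/2} |v+x| ψ(x/L)| ≤ 4M²L²` (`L ≥ 2`).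
[cite: AlpogeFurman2026, Theorem 5.7 (proof: "Rescaling `φ²(u) = ψ(u/L) + O(𝟙_{|u|>L/2−1})` … `g(y) = L(ψ∗ψ)(y/L) + O_χ(1)` uniformly"), p. 11] -/
theorem abs_double_sub_le (hψ : IsWindow ψ) {M : ℝ}
    (hM : ∀ x ∈ Icc (-(1 / 2 : ℝ)) (1 / 2), ψ x ≤ M) {T : ℝ} (hL : 2 ≤ logHeight T) :
    |(∫ v, phi ψ T v ^ 2 * ∫ x in (-(logHeight T / 2))..(logHeight T / 2), |v + x| * phi ψ T x ^ 2) -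
        ∫ v in (-(logHeight T / 2))..(logHeight T / 2), ψ (clampHalf (v / logHeight T)) *
          ∫ x in (-(logHeight T / 2))..(logHeight T / 2), |v + x| * ψ (clampHalf (x / logHeight T))| ≤
      4 * M ^ 2 * logHeight T ^ 2 := by
  set L := logHeight T with hLdef
  have hL0 : 0 < L := by linarith
  have hM0 : 0 ≤ M := (hψ.pos 0 (by norm_num)).le.trans (hM 0 (by norm_num))
  set Nφ : ℝ → ℝ := fun v ↦ ∫ x in (-(L / 2))..(L / 2), |v + x| * phi ψ T x ^ 2 with hNφ
  set Nψ : ℝ → ℝ := fun v ↦ ∫ x in (-(L / 2))..(L / 2), |v + x| * ψ (clampHalf (x / L)) with hNψ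
  have hNφc : Continuous Nφ := continuous_absWeight (hψ.continuous_phi_sq T) L
  have hNψc : Continuous Nψ := continuous_absWeight (hψ.continuous_clamp L) L
  have hψc := hψ.continuous_clamp L
  have hφc := hψ.continuous_phi_sq T
  -- the comparison integral
  have hD := integral_abs_phi_sq_sub_clamp_le hψ hM (T := T) (by rwa [← hLdef])
  rw [← hLdef] at hD
  -- pointwise facts on `[−L/2, L/2]`
  have hw : ∀ v ∈ Icc (-(L / 2)) (L / 2), ∀ x ∈ Icc (-(L / 2)) (L / 2), |v + x| ≤ L := by
    intro v hv x hx
    rw [abs_le]; constructor <;> linarith [hv.1, hv.2, hx.1, hx.2]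
  have hNφ_le : ∀ v ∈ Icc (-(L / 2)) (L / 2), |Nφ v| ≤ L * M * L := by
    intro v hv
    have h := intervalIntegral.norm_integral_le_of_norm_le_const (a := -(L / 2)) (b := L / 2)
      (C := L * M) (f := fun x ↦ |v + x| * phi ψ T x ^ 2) fun x hx ↦ by
        rw [uIoc_of_le (by linarith)] at hx
        rw [Real.norm_eq_abs, abs_mul, abs_abs, abs_of_nonneg (sq_nonneg (phi ψ T x))]
        exact mul_le_mul (hw v hv x ⟨hx.1.le, hx.2⟩) (phi_sq_le hψ hM T x) (sq_nonneg _) (by linarith)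
    rw [Real.norm_eq_abs, show L / 2 - -(L / 2) = L by ring, abs_of_pos hL0] at h
    exact h
  have hdiff_le : ∀ v ∈ Icc (-(L / 2)) (L / 2), |Nφ v - Nψ v| ≤ L * (2 * M) := by
    intro v hv
    have hic : Continuous fun x : ℝ ↦ |v + x| * (phi ψ T x ^ 2 - ψ (clampHalf (x / L))) :=
      (continuous_abs.comp (continuous_const.add continuous_id)).mul (hφc.sub hψc)
    have hi1 : IntervalIntegrable (fun x : ℝ ↦ |v + x| * phi ψ T x ^ 2) volume (-(L / 2)) (L / 2) := by
      exact ((continuous_abs.comp (continuous_const.add continuous_id)).mul hφc).intervalIntegrable _ _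
    have hi2 : IntervalIntegrable (fun x : ℝ ↦ |v + x| * ψ (clampHalf (x / L))) volume (-(L / 2)) (L / 2) := by
      exact ((continuous_abs.comp (continuous_const.add continuous_id)).mul hψc).intervalIntegrable _ _
    have e : Nφ v - Nψ v = ∫ x in (-(L / 2))..(L / 2), |v + x| * (phi ψ T x ^ 2 - ψ (clampHalf (x / L))) := by
      simp only [hNφ, hNψ]
      rw [← intervalIntegral.integral_sub hi1 hi2]
      refine intervalIntegral.integral_congr fun x _ ↦ ?_
      ring
    rw [e]
    calc |∫ x in (-(L / 2))..(L / 2), |v + x| * (phi ψ T x ^ 2 - ψ (clampHalf (x / L)))|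
        ≤ ∫ x in (-(L / 2))..(L / 2), |(|v + x| * (phi ψ T x ^ 2 - ψ (clampHalf (x / L))))| :=
          intervalIntegral.abs_integral_le_integral_abs (by linarith)
      _ ≤ ∫ x in (-(L / 2))..(L / 2), L * |phi ψ T x ^ 2 - ψ (clampHalf (x / L))| := by
          refine intervalIntegral.integral_mono_on (by linarith)
            (by exact (continuous_abs.comp hic).intervalIntegrable _ _)
            (by exact (continuous_const.mul (continuous_abs.comp (hφc.sub hψc))).intervalIntegrable _ _)
            fun x hx ↦ ?_
          rw [abs_mul, abs_abs]
          exact mul_le_mul_of_nonneg_right (hw v hv x hx) (abs_nonneg _)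
      _ = L * ∫ x in (-(L / 2))..(L / 2), |phi ψ T x ^ 2 - ψ (clampHalf (x / L))| :=
          intervalIntegral.integral_const_mul _ _
      _ ≤ L * (2 * M) := mul_le_mul_of_nonneg_left hD hL0.le
  -- the outer integral over `ℝ` is over `[−L/2, L/2]`
  have hzero : ∀ v ∉ Icc (-(L / 2)) (L / 2), phi ψ T v ^ 2 * Nφ v = 0 := by
    intro v hv
    rw [mem_Icc, not_and_or, not_le, not_le] at hv
    have hv' : L / 2 ≤ |v| := by
      rcases hv with hv | hv
      · rw [abs_of_neg (by linarith)]; linarith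
      · rw [abs_of_pos (by linarith)]; linarith
    rw [phi_sq_eq_zero_of_le_abs (by rwa [← hLdef]), zero_mul]
  have houter : (∫ v, phi ψ T v ^ 2 * Nφ v) = ∫ v in (-(L / 2))..(L / 2), phi ψ T v ^ 2 * Nφ v := by
    rw [← setIntegral_eq_integral_of_forall_compl_eq_zero hzero, intervalIntegral.integral_of_le
      (by linarith), integral_Icc_eq_integral_Ioc]
  show |(∫ v, phi ψ T v ^ 2 * Nφ v) - ∫ v in (-(L / 2))..(L / 2), ψ (clampHalf (v / L)) * Nψ v| ≤
    4 * M ^ 2 * L ^ 2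
  have hj1 : IntervalIntegrable (fun v : ℝ ↦ phi ψ T v ^ 2 * Nφ v) volume (-(L / 2)) (L / 2) := by
    exact (hφc.mul hNφc).intervalIntegrable _ _
  have hj2 : IntervalIntegrable (fun v : ℝ ↦ ψ (clampHalf (v / L)) * Nψ v) volume (-(L / 2)) (L / 2) := by
    exact (hψc.mul hNψc).intervalIntegrable _ _
  have hj3 : IntervalIntegrable (fun v : ℝ ↦ |phi ψ T v ^ 2 * Nφ v - ψ (clampHalf (v / L)) * Nψ v|)
      volume (-(L / 2)) (L / 2) := by
    exact (continuous_abs.comp ((hφc.mul hNφc).sub (hψc.mul hNψc))).intervalIntegrable _ _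
  have hj4 : IntervalIntegrable (fun v : ℝ ↦ |phi ψ T v ^ 2 - ψ (clampHalf (v / L))| * (L * M * L))
      volume (-(L / 2)) (L / 2) := by
    exact ((continuous_abs.comp (hφc.sub hψc)).mul continuous_const).intervalIntegrable _ _
  have hj5 : IntervalIntegrable (fun _ : ℝ ↦ M * (L * (2 * M))) volume (-(L / 2)) (L / 2) :=
    continuous_const.intervalIntegrable _ _
  rw [houter, ← intervalIntegral.integral_sub hj1 hj2]
  have hpt : ∀ v ∈ Icc (-(L / 2)) (L / 2),
      |phi ψ T v ^ 2 * Nφ v - ψ (clampHalf (v / L)) * Nψ v| ≤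
        |phi ψ T v ^ 2 - ψ (clampHalf (v / L))| * (L * M * L) + M * (L * (2 * M)) := by
    intro v hv
    have e : phi ψ T v ^ 2 * Nφ v - ψ (clampHalf (v / L)) * Nψ v =
        (phi ψ T v ^ 2 - ψ (clampHalf (v / L))) * Nφ v + ψ (clampHalf (v / L)) * (Nφ v - Nψ v) := by ring
    rw [e]
    have hψv : 0 < ψ (clampHalf (v / L)) := hψ.pos _ (clampHalf_mem _)
    calc |(phi ψ T v ^ 2 - ψ (clampHalf (v / L))) * Nφ v + ψ (clampHalf (v / L)) * (Nφ v - Nψ v)|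
        ≤ |(phi ψ T v ^ 2 - ψ (clampHalf (v / L))) * Nφ v| + |ψ (clampHalf (v / L)) * (Nφ v - Nψ v)| :=
          abs_add_le _ _
      _ ≤ |phi ψ T v ^ 2 - ψ (clampHalf (v / L))| * (L * M * L) + M * (L * (2 * M)) := by
          rw [abs_mul, abs_mul, abs_of_pos hψv]
          exact add_le_add (mul_le_mul_of_nonneg_left (hNφ_le v hv) (abs_nonneg _))
            (mul_le_mul (hM _ (clampHalf_mem _)) (hdiff_le v hv) (abs_nonneg _) hM0)
  have hFi : IntervalIntegrable (fun v : ℝ ↦ |phi ψ T v ^ 2 - ψ (clampHalf (v / L))| * (L * M * L) +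
      M * (L * (2 * M))) volume (-(L / 2)) (L / 2) := by
    exact (((continuous_abs.comp (hφc.sub hψc)).mul continuous_const).add
      continuous_const).intervalIntegrable _ _
  calc |∫ v in (-(L / 2))..(L / 2), (phi ψ T v ^ 2 * Nφ v - ψ (clampHalf (v / L)) * Nψ v)|
      ≤ ∫ v in (-(L / 2))..(L / 2), |phi ψ T v ^ 2 * Nφ v - ψ (clampHalf (v / L)) * Nψ v| :=
        intervalIntegral.abs_integral_le_integral_abs (by linarith)
    _ ≤ ∫ v in (-(L / 2))..(L / 2),
          (|phi ψ T v ^ 2 - ψ (clampHalf (v / L))| * (L * M * L) + M * (L * (2 * M))) :=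
        intervalIntegral.integral_mono_on (by linarith) hj3 hFi hpt
    _ = (∫ v in (-(L / 2))..(L / 2), |phi ψ T v ^ 2 - ψ (clampHalf (v / L))|) * (L * M * L) +
          (L / 2 - -(L / 2)) * (M * (L * (2 * M))) := by
        rw [intervalIntegral.integral_add hj4 hj5, intervalIntegral.integral_mul_const,
          intervalIntegral.integral_const, smul_eq_mul]
    _ ≤ 2 * M * (L * M * L) + (L / 2 - -(L / 2)) * (M * (L * (2 * M))) := by
        have h := mul_le_mul_of_nonneg_right hD (by positivity : 0 ≤ L * M * L)
        linarith
    _ = 4 * M ^ 2 * L ^ 2 := by ring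

/-- **The rescaled double integral is `L³ ∬ |s − t| ψ(s)ψ(t)`**:
`∫_{−L/2}^{L/2} ψ(v/L) ∫_{−L/2}^{L/2} |v + x| ψ(x/L) dx dv = L³ ∫_{−½}^{½}∫_{−½}^{½} |s − t| ψ(s)ψ(t) dt ds`
(`v = Ls`, `x = −Lt`, `ψ` even). [cite: AlpogeFurman2026, Theorem 5.7 (proof) and Lemma 5.6 eq. (5.10), p. 11] -/
theorem double_clamp_eq (hψ : IsWindow ψ) {L : ℝ} (hL : 0 < L) :
    ∫ v in (-(L / 2))..(L / 2), ψ (clampHalf (v / L)) *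
        ∫ x in (-(L / 2))..(L / 2), |v + x| * ψ (clampHalf (x / L)) =
      L ^ 3 * ∫ s in (-(1 / 2 : ℝ))..(1 / 2), ∫ t in (-(1 / 2 : ℝ))..(1 / 2), |s - t| * (ψ s * ψ t) := by
  have e1 : -(L / 2) / L = -(1 / 2 : ℝ) := by field_simp
  have e2 : L / 2 / L = (1 / 2 : ℝ) := by field_simp
  have hmul : ∀ y : ℝ, L * (y / L) = y := fun y ↦ by field_simp
  -- inner substitution `x = Lt`
  have hinner : ∀ v : ℝ, ∫ x in (-(L / 2))..(L / 2), |v + x| * ψ (clampHalf (x / L)) =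
      L * ∫ t in (-(1 / 2 : ℝ))..(1 / 2), |v + L * t| * ψ t := by
    intro v
    calc ∫ x in (-(L / 2))..(L / 2), |v + x| * ψ (clampHalf (x / L))
        = ∫ x in (-(L / 2))..(L / 2), (fun y : ℝ ↦ |v + L * y| * ψ (clampHalf y)) (x / L) := by
          refine intervalIntegral.integral_congr fun x _ ↦ ?_
          show |v + x| * ψ (clampHalf (x / L)) = |v + L * (x / L)| * ψ (clampHalf (x / L))
          rw [hmul]
      _ = L • ∫ y in (-(L / 2) / L)..(L / 2 / L), |v + L * y| * ψ (clampHalf y) :=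
          intervalIntegral.integral_comp_div (fun y : ℝ ↦ |v + L * y| * ψ (clampHalf y)) hL.ne'
      _ = L * ∫ t in (-(1 / 2 : ℝ))..(1 / 2), |v + L * t| * ψ t := by
          rw [smul_eq_mul, e1, e2]
          congr 1
          refine intervalIntegral.integral_congr fun t ht ↦ ?_
          rw [uIcc_of_le (by norm_num)] at ht
          show |v + L * t| * ψ (clampHalf t) = |v + L * t| * ψ t
          rw [clampHalf_of_mem ht]
  simp_rw [hinner]
  -- outer substitution `v = Ls`
  have houter : ∫ v in (-(L / 2))..(L / 2), ψ (clampHalf (v / L)) *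
      (L * ∫ t in (-(1 / 2 : ℝ))..(1 / 2), |v + L * t| * ψ t) =
      L * ∫ s in (-(1 / 2 : ℝ))..(1 / 2), ψ s *
        (L * ∫ t in (-(1 / 2 : ℝ))..(1 / 2), |L * s + L * t| * ψ t) := by
    calc ∫ v in (-(L / 2))..(L / 2), ψ (clampHalf (v / L)) *
          (L * ∫ t in (-(1 / 2 : ℝ))..(1 / 2), |v + L * t| * ψ t)
        = ∫ v in (-(L / 2))..(L / 2), (fun y : ℝ ↦ ψ (clampHalf y) *
            (L * ∫ t in (-(1 / 2 : ℝ))..(1 / 2), |L * y + L * t| * ψ t)) (v / L) := by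
          refine intervalIntegral.integral_congr fun v _ ↦ ?_
          show _ = ψ (clampHalf (v / L)) * (L * ∫ t in (-(1 / 2 : ℝ))..(1 / 2), |L * (v / L) + L * t| * ψ t)
          simp only [hmul]
      _ = L • ∫ y in (-(L / 2) / L)..(L / 2 / L), ψ (clampHalf y) *
            (L * ∫ t in (-(1 / 2 : ℝ))..(1 / 2), |L * y + L * t| * ψ t) :=
          intervalIntegral.integral_comp_div (fun y : ℝ ↦ ψ (clampHalf y) *
            (L * ∫ t in (-(1 / 2 : ℝ))..(1 / 2), |L * y + L * t| * ψ t)) hL.ne'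
      _ = L * ∫ s in (-(1 / 2 : ℝ))..(1 / 2), ψ s *
            (L * ∫ t in (-(1 / 2 : ℝ))..(1 / 2), |L * s + L * t| * ψ t) := by
          rw [smul_eq_mul, e1, e2]
          congr 1
          refine intervalIntegral.integral_congr fun s hs ↦ ?_
          rw [uIcc_of_le (by norm_num)] at hs
          show ψ (clampHalf s) * _ = ψ s * _
          rw [clampHalf_of_mem hs]
  rw [houter]
  -- `|Ls + Lt| = L|s+t|`, `∫|s+t|ψ(t) = ∫|s−t|ψ(t)` (`ψ` even), constants out
  have hin2 : ∀ s : ℝ, ∫ t in (-(1 / 2 : ℝ))..(1 / 2), |L * s + L * t| * ψ t =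
      L * ∫ t in (-(1 / 2 : ℝ))..(1 / 2), |s - t| * ψ t := by
    intro s
    have e3 : ∫ t in (-(1 / 2 : ℝ))..(1 / 2), |L * s + L * t| * ψ t =
        L * ∫ t in (-(1 / 2 : ℝ))..(1 / 2), |s + t| * ψ t := by
      rw [← intervalIntegral.integral_const_mul]
      refine intervalIntegral.integral_congr fun t _ ↦ ?_
      show |L * s + L * t| * ψ t = L * (|s + t| * ψ t)
      rw [← mul_add, abs_mul, abs_of_pos hL]
      ring
    have e4 : ∫ t in (-(1 / 2 : ℝ))..(1 / 2), |s + t| * ψ t =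
        ∫ t in (-(1 / 2 : ℝ))..(1 / 2), (fun t : ℝ ↦ |s - t| * ψ t) (-t) := by
      refine intervalIntegral.integral_congr fun t _ ↦ ?_
      show |s + t| * ψ t = |s - -t| * ψ (-t)
      rw [sub_neg_eq_add, hψ.even]
    rw [e3, e4, intervalIntegral.integral_comp_neg (fun t : ℝ ↦ |s - t| * ψ t)]
    norm_num
  simp_rw [hin2]
  have e5 : ∀ s : ℝ, ψ s * (L * (L * ∫ t in (-(1 / 2 : ℝ))..(1 / 2), |s - t| * ψ t)) =
      L * L * ∫ t in (-(1 / 2 : ℝ))..(1 / 2), |s - t| * (ψ s * ψ t) := by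
    intro s
    calc ψ s * (L * (L * ∫ t in (-(1 / 2 : ℝ))..(1 / 2), |s - t| * ψ t))
        = L * L * (ψ s * ∫ t in (-(1 / 2 : ℝ))..(1 / 2), |s - t| * ψ t) := by ring
      _ = L * L * ∫ t in (-(1 / 2 : ℝ))..(1 / 2), ψ s * (|s - t| * ψ t) := by
          rw [intervalIntegral.integral_const_mul]
      _ = L * L * ∫ t in (-(1 / 2 : ℝ))..(1 / 2), |s - t| * (ψ s * ψ t) := by
          congr 1
          refine intervalIntegral.integral_congr fun t _ ↦ ?_
          show ψ s * (|s - t| * ψ t) = |s - t| * (ψ s * ψ t)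
          ring
  simp_rw [e5]
  rw [intervalIntegral.integral_const_mul]
  ring

/-- **`Σ_{n≤X} (Λ(n)²/n) g(log n) = (L³/2) ∬|s−t|ψψ + O(L²)`** — the evaluation of the prime-side main
term of Theorem 5.7: for a window `ψ` there is `C ≥ 0` with
`|Σ_{1≤n≤T/2π} (Λ(n)/√n)² g(log n) − (L³/2)∫_{−½}^{½}∫_{−½}^{½}|s−t|ψ(s)ψ(t)| ≤ C L²` for all `T` with `L ≥ 2`
(`g = gConv ψ T = φ_T² ⋆ φ_T²`). [cite: AlpogeFurman2026, Theorem 5.7 (proof: "by partial summation … this equals `L³∫_0^1 w(ψ∗ψ)(w)dw + O_χ(L²)`", "`2∫_0^1 w(ψ∗ψ) = ∬|u−v|ψψ`"), p. 11] -/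
theorem exists_sum_gConv_bound (hψ : IsWindow ψ) :
    ∃ C : ℝ, 0 ≤ C ∧ ∀ T : ℝ, 0 < T → 2 ≤ logHeight T →
      |∑ n ∈ Finset.Icc 1 ⌊T / (2 * π)⌋₊, ((Λ n : ℝ) / Real.sqrt n) ^ 2 * gConv ψ T (Real.log n) -
          logHeight T ^ 3 / 2 * ∫ s in (-(1 / 2 : ℝ))..(1 / 2), ∫ t in (-(1 / 2 : ℝ))..(1 / 2),
            |s - t| * (ψ s * ψ t)| ≤ C * logHeight T ^ 2 := by
  -- window constants
  obtain ⟨m₀, B, K₀, -, hB0, -, -, hB, -⟩ := hψ.exists_bounds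
  have hM : ∀ x ∈ Icc (-(1 / 2 : ℝ)) (1 / 2), ψ x ≤ B ^ 2 := hψ.le_sq_of_sqrt_le hB
  set M : ℝ := B ^ 2 with hMdef
  have hM0 : 0 ≤ M := sq_nonneg _
  obtain ⟨K, hK0, hK⟩ := exists_hasDerivAt_phi_sq hψ
  -- the Chebyshev-type input `Σ_{n≤t} Λ(n)²/n = ½log²t + O(log t)`
  obtain ⟨C₀, hC₀⟩ := AlpogeFurman2026_sum_vonMangoldt_sq_div
  set C : ℝ := max C₀ 0 with hCdef
  have hC0 : 0 ≤ C := le_max_right _ _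
  have hE : ∀ t : ℝ, 1 ≤ t →
      |∑ k ∈ Finset.Icc 0 ⌊t⌋₊, Λ k ^ 2 / (k : ℝ) - Real.log t ^ 2 / 2| ≤ C * Real.log t + 1 := by
    intro t ht
    rcases le_or_gt 2 t with h2 | h2
    · have h := hC₀ t h2
      have hlog : 0 ≤ Real.log t := Real.log_nonneg ht
      calc |∑ k ∈ Finset.Icc 0 ⌊t⌋₊, Λ k ^ 2 / (k : ℝ) - Real.log t ^ 2 / 2| ≤ C₀ * Real.log t := h
        _ ≤ C * Real.log t + 1 := by nlinarith [le_max_left C₀ 0]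
    · have hfl : ⌊t⌋₊ = 1 := by
        rw [Nat.floor_eq_iff (by linarith)]
        constructor <;> push_cast <;> linarith
      rw [hfl]
      have hsum : ∑ k ∈ Finset.Icc 0 1, Λ k ^ 2 / (k : ℝ) = 0 := by
        rw [Finset.sum_eq_zero]
        intro k hk
        rw [Finset.mem_Icc] at hk
        obtain ⟨-, hk⟩ := hk
        interval_cases k <;> simp [ArithmeticFunction.vonMangoldt_apply_one]
      rw [hsum, zero_sub, abs_neg]
      have hlog : 0 ≤ Real.log t := Real.log_nonneg ht
      have hlog2 : Real.log t ≤ 1 := by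
        have h := Real.log_le_sub_one_of_pos (by linarith : (0 : ℝ) < t)
        linarith
      rw [abs_of_nonneg (by positivity)]
      nlinarith
  refine ⟨(C + 1) * (M + K) * M + 2 * M ^ 2, by positivity, fun T hT0 hL2 ↦ ?_⟩
  set L := logHeight T with hLdef
  have hL1 : 1 ≤ L := by linarith
  have hL0 : 0 < L := by linarith
  obtain ⟨d, hdc, hd, -, hdint, hdK⟩ := hK T (by rwa [← hLdef])
  have hX : T / (2 * π) = Real.exp L := by
    rw [hLdef, logHeight, Real.exp_log (by positivity)]
  -- rewrite the sum in the `Σ_{k ∈ [0,X]} g(log k)·Λ(k)²/k` form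
  have hsum : ∑ n ∈ Finset.Icc 1 ⌊T / (2 * π)⌋₊, ((Λ n : ℝ) / Real.sqrt n) ^ 2 * gConv ψ T (Real.log n) =
      ∑ k ∈ Finset.Icc 0 ⌊Real.exp L⌋₊, gConv ψ T (Real.log k) * (Λ k ^ 2 / (k : ℝ)) := by
    rw [hX]
    have h0 : Finset.Icc 0 ⌊Real.exp L⌋₊ = insert 0 (Finset.Icc 1 ⌊Real.exp L⌋₊) := by
      ext k; simp only [Finset.mem_insert, Finset.mem_Icc]; omega
    rw [h0, Finset.sum_insert (by simp)]
    simp only [ArithmeticFunction.map_zero, Nat.cast_zero, zero_pow two_ne_zero, zero_div, mul_zero,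
      zero_add]
    refine Finset.sum_congr rfl fun n hn ↦ ?_
    rw [div_pow, Real.sq_sqrt (Nat.cast_nonneg n)]
    ring
  rw [hsum]
  have h1 := abs_sum_gConv_sub_le hψ (T := T) (by rwa [← hLdef]) hdc hd hdint hdK hM hC0 hE
  rw [← hLdef] at h1
  have h2 := integral_moment_eq_half hψ T
  rw [← hLdef] at h2
  have h3 := abs_double_sub_le hψ hM (T := T) (by rwa [← hLdef])
  rw [← hLdef] at h3
  have h4 := double_clamp_eq hψ hL0
  rw [h4] at h3
  have hF2 : (∫ v : ℝ, phi ψ T v ^ 2) ≤ M * L := by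
    have h := (integral_phi_le hψ hM0 hM T).2
    rwa [← hLdef, max_eq_left hL0.le] at h
  have hF20 : 0 ≤ ∫ v : ℝ, phi ψ T v ^ 2 := integral_nonneg fun v ↦ sq_nonneg _
  set S₀ := ∑ k ∈ Finset.Icc 0 ⌊Real.exp L⌋₊, gConv ψ T (Real.log k) * (Λ k ^ 2 / (k : ℝ)) with hS₀
  set I₁ := ∫ v, phi ψ T v ^ 2 * ∫ y in (0 : ℝ)..L, phi ψ T (y - v) ^ 2 * y with hI₁
  set I₂ := ∫ v, phi ψ T v ^ 2 * ∫ x in (-(L / 2))..(L / 2), |v + x| * phi ψ T x ^ 2 with hI₂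
  set D := ∫ s in (-(1 / 2 : ℝ))..(1 / 2), ∫ t in (-(1 / 2 : ℝ))..(1 / 2), |s - t| * (ψ s * ψ t) with hDdef
  -- `|S₀ − I₁| ≤ (CL+1)(M+K)·ML`, `I₁ = I₂/2`, `|I₂ − L³D| ≤ 4M²L²`
  have e1 : |S₀ - I₁| ≤ (C * L + 1) * (M + K) * (M * L) :=
    h1.trans (mul_le_mul_of_nonneg_left hF2 (by positivity))
  have e2 : I₁ = 1 / 2 * I₂ := h2
  have key : S₀ - L ^ 3 / 2 * D = (S₀ - I₁) + 1 / 2 * (I₂ - L ^ 3 * D) := by rw [e2]; ring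
  rw [key]
  calc |(S₀ - I₁) + 1 / 2 * (I₂ - L ^ 3 * D)| ≤ |S₀ - I₁| + |1 / 2 * (I₂ - L ^ 3 * D)| := abs_add_le _ _
    _ ≤ (C * L + 1) * (M + K) * (M * L) + 1 / 2 * (4 * M ^ 2 * L ^ 2) := by
        rw [abs_mul, abs_of_pos (by norm_num : (0 : ℝ) < 1 / 2)]
        exact add_le_add e1 (mul_le_mul_of_nonneg_left h3 (by norm_num))
    _ ≤ ((C + 1) * (M + K) * M + 2 * M ^ 2) * L ^ 2 := by
        have h5 : C * L + 1 ≤ (C + 1) * L := by nlinarith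
        have h6 : (C * L + 1) * (M + K) * (M * L) ≤ (C + 1) * L * (M + K) * (M * L) := by
          have := mul_le_mul_of_nonneg_right h5 (by positivity : 0 ≤ (M + K) * (M * L))
          nlinarith
        nlinarith


/-! ## §H5. The dyadic zero count `N(T,2T) = TL/2π + O(T)` -/

/-- `log(2π) ≤ 2`. [cite: AlpogeFurman2026, §1.1 (p. 1)] -/
private theorem log_two_pi_le_two'' : Real.log (2 * π) ≤ 2 := by
  have hπ4 := Real.pi_lt_d4
  have he := Real.exp_one_gt_d9
  rw [Real.log_le_iff_le_exp (by positivity)]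
  have h : Real.exp 2 = Real.exp 1 * Real.exp 1 := by rw [← Real.exp_add]; norm_num
  rw [h]
  nlinarith

/-- **`|N(2T) − N(T) − TL/2π| ≤ T`** for `T ≥ 260` (from the tree's explicit Riemann–von Mangoldt formula
`|N(T) − (T/2π)log(T/2πe)| ≤ 0.3083 log T + 7.7`). In [AF26]: "`N(T,2T) = (T/2π)(log(T/2π) + 2log2) −
T/2π + O(log T)`" (§1.1). [cite: AlpogeFurman2026, §1.1 (p. 1)] -/
theorem abs_dyadic_count_sub_le {T : ℝ} (hT : 260 ≤ T) :
    |(zetaZeroCount (2 * T) : ℝ) - zetaZeroCount T - T * logHeight T / (2 * π)| ≤ T := by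
  have hπ := Real.pi_gt_three
  have hπ4 := Real.pi_lt_d4
  have he := Real.exp_one_lt_d9
  have he' := Real.exp_one_gt_d9
  have hT0 : 0 < T := by linarith
  have hTe : Real.exp 1 ≤ T := by linarith
  have h2Te : Real.exp 1 ≤ 2 * T := by linarith
  have h1 := abs_zetaZeroCount_sub_main_le_explicit' hTe
  have h2 := abs_zetaZeroCount_sub_main_le_explicit' h2Te
  rw [abs_le] at h1 h2
  have hL1 : Real.log (T / (2 * π * Real.exp 1)) = logHeight T - 1 := by
    rw [show T / (2 * π * Real.exp 1) = T / (2 * π) / Real.exp 1 by ring, Real.log_div (by positivity)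
      (Real.exp_pos 1).ne', Real.log_exp, logHeight]
  have hL2 : Real.log (2 * T / (2 * π * Real.exp 1)) = logHeight T + Real.log 2 - 1 := by
    rw [show 2 * T / (2 * π * Real.exp 1) = 2 * (T / (2 * π)) / Real.exp 1 by ring,
      Real.log_div (by positivity) (Real.exp_pos 1).ne', Real.log_exp,
      Real.log_mul (by norm_num) (by positivity), logHeight]
    ring
  rw [hL1] at h1
  rw [hL2] at h2
  have hlogT : Real.log T ≤ logHeight T + 2 := by
    rw [log_eq_logHeight_add hT0]; linarith [log_two_pi_le_two'']
  have hlog2T : Real.log (2 * T) ≤ logHeight T + 3 := by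
    rw [Real.log_mul (by norm_num) hT0.ne', log_eq_logHeight_add hT0]
    linarith [log_two_pi_le_two'', Real.log_two_lt_d9]
  have hlog2 := Real.log_two_gt_d9
  have hlog2' := Real.log_two_lt_d9
  have hLT : logHeight T ≤ T := (logHeight_le_two_sqrt hT0).2
  have hLge : 1 ≤ logHeight T := by
    rw [logHeight, Real.le_log_iff_exp_le (by positivity), le_div_iff₀ (by positivity)]
    nlinarith
  have hTpi : T / (2 * π) ≤ T / 6 := by
    rw [div_le_div_iff₀ (by positivity) (by norm_num)]; nlinarith
  have hTpi0 : 0 ≤ T / (2 * π) := by positivity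
  have hmain : 2 * T / (2 * π) * (logHeight T + Real.log 2 - 1) - T / (2 * π) * (logHeight T - 1) -
      T * logHeight T / (2 * π) = T / (2 * π) * (2 * Real.log 2 - 1) := by ring
  rw [abs_le]
  constructor
  · nlinarith
  · nlinarith

/-! ## §H6. Assembly: Theorem 5.7 for the typed model -/

/-- `∫_{−½}^{½} ψ ≥ m₀ > 0` for a window with floor `m₀`. [cite: AlpogeFurman2026, §2.2 (p. 4: "`ψ > 0` on `[−½,½]`")] -/
theorem integral_window_ge (hψ : IsWindow ψ) {m₀ : ℝ}
    (hfloor : ∀ x ∈ Icc (-(1 / 2 : ℝ)) (1 / 2), m₀ ≤ ψ x) :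
    m₀ ≤ ∫ u in (-(1 / 2 : ℝ))..(1 / 2), ψ u := by
  have h := intervalIntegral.integral_mono_on (by norm_num : (-(1 / 2 : ℝ)) ≤ 1 / 2)
    (continuous_const.intervalIntegrable (μ := volume) (-(1 / 2 : ℝ)) (1 / 2))
    (hψ.continuousOn.intervalIntegrable_of_Icc (by norm_num)) (fun x hx ↦ hfloor x hx)
  rw [intervalIntegral.integral_const, smul_eq_mul] at h
  linarith

/-- The window algebra of Lemma 5.6 inside Theorem 5.7: with `F₂ = LI₁ + O(M)`, `F₄ = LI₂ + O(M²)` and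
`R I₁² = I₂ + D`, `L F₄ + L² D − R F₂² = O(L)`. [cite: AlpogeFurman2026, Theorem 5.7 (proof: "Dividing by `a²L² = L²(∫ψ)² + O_χ(L)`"), p. 11] -/
theorem window_algebra {L F₂ F₄ I₁ I₂ D R M : ℝ} (hL : 1 ≤ L)
    (hRI : R * I₁ ^ 2 = I₂ + D) (he₂ : |F₂ - L * I₁| ≤ 2 * M) (he₄ : |F₄ - L * I₂| ≤ 2 * M ^ 2) :
    |L * F₄ + L ^ 2 * D - R * F₂ ^ 2| ≤ L * (2 * M ^ 2 + |R| * (4 * |I₁| * M + 4 * M ^ 2)) := by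
  have hL0 : 0 < L := by linarith
  set e₂ := F₂ - L * I₁ with he₂def
  set e₄ := F₄ - L * I₂ with he₄def
  have e : L * F₄ + L ^ 2 * D - R * F₂ ^ 2 = L * e₄ - R * (2 * L * I₁ * e₂ + e₂ ^ 2) := by
    have h1 : F₂ = L * I₁ + e₂ := by rw [he₂def]; ring
    have h2 : F₄ = L * I₂ + e₄ := by rw [he₄def]; ring
    rw [h1, h2]
    have h3 : R * (L * I₁ + e₂) ^ 2 = R * I₁ ^ 2 * L ^ 2 + R * (2 * L * I₁ * e₂ + e₂ ^ 2) := by ring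
    rw [h3, hRI]
    ring
  rw [e]
  have h1 : |L * e₄| ≤ L * (2 * M ^ 2) := by
    rw [abs_mul, abs_of_pos hL0]; exact mul_le_mul_of_nonneg_left he₄ hL0.le
  have he0 : 0 ≤ |e₂| := abs_nonneg _
  have hI : |2 * L * I₁ * e₂| = 2 * L * |I₁| * |e₂| := by
    rw [abs_mul, abs_mul, abs_mul, abs_of_pos (by norm_num : (0 : ℝ) < 2), abs_of_pos hL0]
  have h2 : |2 * L * I₁ * e₂ + e₂ ^ 2| ≤ 4 * |I₁| * M * L + 4 * M ^ 2 := by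
    calc |2 * L * I₁ * e₂ + e₂ ^ 2| ≤ |2 * L * I₁ * e₂| + |e₂ ^ 2| := abs_add_le _ _
      _ = 2 * L * |I₁| * |e₂| + |e₂| ^ 2 := by rw [hI, abs_pow]
      _ ≤ 2 * L * |I₁| * (2 * M) + (2 * M) ^ 2 :=
          add_le_add (mul_le_mul_of_nonneg_left he₂ (by positivity)) (pow_le_pow_left₀ he0 he₂ 2)
      _ = 4 * |I₁| * M * L + 4 * M ^ 2 := by ring
  have h3 : |R * (2 * L * I₁ * e₂ + e₂ ^ 2)| ≤ |R| * (4 * |I₁| * M * L + 4 * M ^ 2) := by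
    rw [abs_mul]; exact mul_le_mul_of_nonneg_left h2 (abs_nonneg _)
  have h4 : |R| * (4 * M ^ 2) ≤ |R| * (4 * M ^ 2) * L := le_mul_of_one_le_right (by positivity) hL
  have e1 : L * (2 * M ^ 2 + |R| * (4 * |I₁| * M + 4 * M ^ 2)) =
      L * (2 * M ^ 2) + (|R| * (4 * |I₁| * M * L) + |R| * (4 * M ^ 2) * L) := by ring
  have e2 : |R| * (4 * |I₁| * M * L + 4 * M ^ 2) = |R| * (4 * |I₁| * M * L) + |R| * (4 * M ^ 2) := by ring
  calc |L * e₄ - R * (2 * L * I₁ * e₂ + e₂ ^ 2)| ≤ |L * e₄| + |R * (2 * L * I₁ * e₂ + e₂ ^ 2)| :=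
        abs_sub _ _
    _ ≤ L * (2 * M ^ 2) + |R| * (4 * |I₁| * M * L + 4 * M ^ 2) := add_le_add h1 h3
    _ ≤ L * (2 * M ^ 2 + |R| * (4 * |I₁| * M + 4 * M ^ 2)) := by rw [e1, e2]; linarith

/-- `|a+b+c+d+e+f| ≤ |a|+|b|+|c|+|d|+|e|+|f|`. [cite: AlpogeFurman2026, Theorem 5.7 (proof), p. 11] -/
private theorem abs_add_six (a b c d e f : ℝ) :
    |a + b + c + d + e + f| ≤ |a| + |b| + |c| + |d| + |e| + |f| := by
  have h1 := abs_add_le (a + b + c + d + e) f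
  have h2 := abs_add_le (a + b + c + d) e
  have h3 := abs_add_le (a + b + c) d
  have h4 := abs_add_le (a + b) c
  have h5 := abs_add_le a b
  linarith

end AlpogeFurman2026

open AlpogeFurman2026

set_option maxHeartbeats 400000 in
/-- **[AF26] Theorem 5.7, PROVED for the typed model**: `‖G̃‖²_HS = (R(ψ) + O(L⁻¹)) N(T,2T)` —
for every window `ψ` there are `C, T₀` with `|tr(G̃²) − R(ψ)(N(2T) − N(T))| ≤ C (N(2T) − N(T))/L`
for all `T ≥ T₀`. The proof follows the printed one: Proposition 4.3 (the tail `Ẽ`,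
`AlpogeFurman2026_trace_sq_perturbation`), Proposition 5.2 (`AlpogeFurman2026_reduction`),
Proposition 5.3 (`AlpogeFurman2026_arch_term`), Proposition 5.4 (`AlpogeFurman2026_prime_term`),
Proposition 5.5 (`AlpogeFurman2026_formM_split`, `AlpogeFurman2026_cross_arch_prime`), the rescaling
`‖φ‖₂² = L∫ψ + O(1)`, `‖φ‖₄⁴ = L∫ψ² + O(1)`, the partial summation
`Σ(Λ(n)²/n)g(log n) = (L³/2)∬|s−t|ψψ + O(L²)` (`exists_sum_gConv_bound`), Lemma 5.6 (the algebra of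
`R(ψ)`), and `N(T,2T) = TL/2π + O(T)`; every `O(·)` is an explicit constant depending on `ψ` (and the
fixed ramp `χ = Real.smoothTransition`). This discharges the tree's claim
`AlpogeFurman2026_hilbertSchmidt` for the typed objects; it says nothing about Theorem A or RH.
[cite: AlpogeFurman2026, Theorem 5.7 and its proof (p. 11)] -/
theorem AlpogeFurman2026_hilbertSchmidt_holds : AlpogeFurman2026_hilbertSchmidt := by
  intro ψ hψ
  have hπ := Real.pi_gt_three
  have hπ4 := Real.pi_lt_d4
  -- window constants
  obtain ⟨m₀, B, K₀, hm₀, hB0, -, hfloor, hB, -⟩ := hψ.exists_bounds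
  have hM : ∀ x ∈ Icc (-(1 / 2 : ℝ)) (1 / 2), ψ x ≤ B ^ 2 := hψ.le_sq_of_sqrt_le hB
  have hM0 : 0 ≤ B ^ 2 := sq_nonneg _
  have hI₁pos : 0 < ∫ u in (-(1 / 2 : ℝ))..(1 / 2), ψ u := lt_of_lt_of_le hm₀ (integral_window_ge hψ hfloor)
  have hR' : windowConstant ψ = ((∫ u in (-(1 / 2 : ℝ))..(1 / 2), ψ u ^ 2) +
      ∫ u in (-(1 / 2 : ℝ))..(1 / 2), ∫ v in (-(1 / 2 : ℝ))..(1 / 2), |u - v| * (ψ u * ψ v)) /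
      (∫ u in (-(1 / 2 : ℝ))..(1 / 2), ψ u) ^ 2 := rfl
  -- the analytic inputs
  obtain ⟨C_P, hCP0, hP⟩ := AlpogeFurman2026_trace_sq_perturbation hψ
  obtain ⟨C_R, hCR0, hR⟩ := AlpogeFurman2026_reduction hψ
  obtain ⟨C_s, hCs0, hS⟩ := AlpogeFurman2026_formM_split hψ
  obtain ⟨C_a, hCa0, hA⟩ := AlpogeFurman2026_arch_term hψ
  obtain ⟨C_c, hCc0, hC⟩ := AlpogeFurman2026_cross_arch_prime hψ
  obtain ⟨C_p, hCp0, hPr⟩ := AlpogeFurman2026_prime_term hψ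
  obtain ⟨C_g, hCg0, hG⟩ := exists_sum_gConv_bound hψ
  -- constants (opaque names with their defining equations)
  obtain ⟨M, hMdef⟩ : ∃ M : ℝ, M = B ^ 2 := ⟨_, rfl⟩
  obtain ⟨I₁, hI₁⟩ : ∃ I : ℝ, I = ∫ u in (-(1 / 2 : ℝ))..(1 / 2), ψ u := ⟨_, rfl⟩
  obtain ⟨I₂, hI₂⟩ : ∃ I : ℝ, I = ∫ u in (-(1 / 2 : ℝ))..(1 / 2), ψ u ^ 2 := ⟨_, rfl⟩
  obtain ⟨D, hDdef⟩ : ∃ D' : ℝ, D' = ∫ u in (-(1 / 2 : ℝ))..(1 / 2), ∫ v in (-(1 / 2 : ℝ))..(1 / 2),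
    |u - v| * (ψ u * ψ v) := ⟨_, rfl⟩
  obtain ⟨R, hRdef⟩ : ∃ R' : ℝ, R' = windowConstant ψ := ⟨_, rfl⟩
  rw [← hMdef] at hM hM0
  rw [← hI₁] at hI₁pos hR'
  rw [← hI₂, ← hDdef, ← hRdef] at hR'
  have hI₁ne : I₁ ≠ 0 := hI₁pos.ne'
  have hRI : R * I₁ ^ 2 = I₂ + D := by rw [hR']; field_simp
  set Kalg : ℝ := 2 * M ^ 2 + |R| * (4 * |I₁| * M + 4 * M ^ 2) with hKalg
  have hKalg0 : 0 ≤ Kalg := by positivity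
  set K₁ : ℝ := C_s + C_a + 2 * C_c + C_p + C_g + Kalg with hK₁
  have hK₁0 : 0 ≤ K₁ := by positivity
  set K₂ : ℝ := 4 * (C_R + K₁) / m₀ ^ 2 + |R| with hK₂
  have hK₂0 : 0 ≤ K₂ := by positivity
  set K₃ : ℝ := K₂ + 2 * Real.sqrt (|R| + K₂) * C_P + C_P ^ 2 with hK₃
  have hK₃0 : 0 ≤ K₃ := by positivity
  clear_value Kalg K₁ K₂ K₃
  refine ⟨4 * π * K₃, max 300 (2 * π * Real.exp 10), fun T hT ↦ ?_⟩
  have hT300 : 300 ≤ T := le_trans (le_max_left _ _) hT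
  have hTexp : 2 * π * Real.exp 10 ≤ T := le_trans (le_max_right _ _) hT
  have hT0 : 0 < T := by linarith
  have hT1 : 1 ≤ T := by linarith
  have hL10 : 10 ≤ logHeight T := by
    rw [logHeight, Real.le_log_iff_exp_le (by positivity), le_div_iff₀ (by positivity)]
    linarith
  have hLT : logHeight T ≤ T := (logHeight_le_two_sqrt hT0).2
  -- all `T`-dependent inputs, in raw form
  have h_split := hS T hT300 hL10
  have h_arch := hA T hT300 hL10
  have h_cross := hC T hT300 hL10
  have h_prime := hPr T hT300 hL10
  have h_g := hG T hT0 (by linarith)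
  have h_red := hR T hT300 hL10
  have h_pert := hP T hT300 hL10
  have he₂ := abs_integral_phi_sq_sub_le hψ hM (T := T) (by linarith)
  have he₄ := abs_integral_phi_pow_four_sub_le hψ hM (T := T) (by linarith)
  have hnorm := normalisation_ge hψ hm₀ hfloor (T := T) (by linarith)
  have hcount : |(zetaZeroCount (2 * T) : ℝ) - zetaZeroCount T - T * logHeight T / (2 * π)| ≤ T :=
    abs_dyadic_count_sub_le (by linarith)
  have hcount_ge : T * logHeight T / (4 * π) ≤ (zetaZeroCount (2 * T) : ℝ) - zetaZeroCount T :=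
    dyadic_count_ge (by linarith)
  have hcast : (windowConstant ψ : ℂ) * ((zetaZeroCount (2 * T) : ℂ) - zetaZeroCount T) =
      ((windowConstant ψ * ((zetaZeroCount (2 * T) : ℝ) - zetaZeroCount T) : ℝ) : ℂ) := by
    push_cast; ring
  rw [hcast, ← hRdef]
  rw [← hI₁] at he₂
  rw [← hI₂] at he₄
  rw [← hDdef] at h_g
  -- name the `T`-dependent quantities and make them opaque
  generalize hLdef : logHeight T = L at *
  generalize hF₂ : (∫ u, phi ψ T u ^ 2) = F₂ at *
  generalize hF₄ : (∫ u, phi ψ T u ^ 4) = F₄ at *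
  generalize hBμμ : formB ψ T archDensity archDensity = Bμμ at *
  generalize hBPP : formB ψ T (primeDensity (T / (2 * π))) (primeDensity (T / (2 * π))) = BPP at *
  generalize hBPμ : formB ψ T (primeDensity (T / (2 * π))) archDensity = BPμ at *
  generalize hSg : ∑ n ∈ Finset.Icc 1 ⌊T / (2 * π)⌋₊,
    ((Λ n : ℝ) / Real.sqrt n) ^ 2 * gConv ψ T (Real.log n) = Sg at *
  generalize hMM : formM ψ T = MM at *
  generalize hSdef : ∑ k : Fin (gridDim T), ∑ k' : Fin (gridDim T), sEntry ψ T k k' ^ 2 = S at *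
  generalize hNdy : (zetaZeroCount (2 * T) : ℝ) - zetaZeroCount T = Ndy at *
  generalize hGG : (gramMatrix ψ T * gramMatrix ψ T).trace = GG at *
  have hL1 : 1 ≤ L := by linarith
  have hL0 : 0 < L := by linarith
  have hLF₂pos : 0 < L * F₂ := lt_of_lt_of_le (by positivity) hnorm
  have hF₂pos : 0 < F₂ := pos_of_mul_pos_right hLF₂pos hL0.le
  -- Step 1: `𝓜 = (TL/2π) R F₂² + O(TL²)`
  have halg : |L * F₄ + L ^ 2 * D - R * F₂ ^ 2| ≤ L * Kalg := by
    rw [hKalg]; exact window_algebra hL1 hRI he₂ he₄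
  have hstep1 : |MM - T * L / (2 * π) * R * F₂ ^ 2| ≤ K₁ * T * L ^ 2 := by
    have hTπ : T / π ≤ T := div_le_self hT0.le (by linarith)
    have hTπ0 : 0 < T / π := by positivity
    have hTL : T * L / (2 * π) ≤ T * L := div_le_self (by positivity) (by linarith)
    have hTL0 : 0 < T * L / (2 * π) := by positivity
    have e : MM - T * L / (2 * π) * R * F₂ ^ 2 =
        (MM - (Bμμ + BPP + 2 * BPμ)) + (Bμμ - T * L ^ 2 / (2 * π) * F₄) + 2 * BPμ +
          (BPP - T / π * Sg) + T / π * (Sg - L ^ 3 / 2 * D) +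
          T * L / (2 * π) * (L * F₄ + L ^ 2 * D - R * F₂ ^ 2) := by ring
    rw [e]
    have h5 : |T / π * (Sg - L ^ 3 / 2 * D)| ≤ T * (C_g * L ^ 2) := by
      rw [abs_mul, abs_of_pos hTπ0]
      exact mul_le_mul hTπ h_g (abs_nonneg _) hT0.le
    have h6 : |T * L / (2 * π) * (L * F₄ + L ^ 2 * D - R * F₂ ^ 2)| ≤ T * L * (L * Kalg) := by
      rw [abs_mul, abs_of_pos hTL0]
      exact mul_le_mul hTL halg (abs_nonneg _) (by positivity)
    have h7 : |2 * BPμ| ≤ 2 * (C_c * T * L ^ 2) := by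
      rw [abs_mul, abs_of_pos (by norm_num : (0 : ℝ) < 2)]
      exact mul_le_mul_of_nonneg_left h_cross (by norm_num)
    calc |(MM - (Bμμ + BPP + 2 * BPμ)) + (Bμμ - T * L ^ 2 / (2 * π) * F₄) + 2 * BPμ +
          (BPP - T / π * Sg) + T / π * (Sg - L ^ 3 / 2 * D) +
          T * L / (2 * π) * (L * F₄ + L ^ 2 * D - R * F₂ ^ 2)|
        ≤ |MM - (Bμμ + BPP + 2 * BPμ)| + |Bμμ - T * L ^ 2 / (2 * π) * F₄| + |2 * BPμ| +
          |BPP - T / π * Sg| + |T / π * (Sg - L ^ 3 / 2 * D)| +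
          |T * L / (2 * π) * (L * F₄ + L ^ 2 * D - R * F₂ ^ 2)| := abs_add_six _ _ _ _ _ _
      _ ≤ C_s * T * L ^ 2 + C_a * T * L ^ 2 + 2 * (C_c * T * L ^ 2) + C_p * T * L ^ 2 +
          T * (C_g * L ^ 2) + T * L * (L * Kalg) :=
          add_le_add (add_le_add (add_le_add (add_le_add (add_le_add h_split h_arch) h7) h_prime) h5) h6
      _ = K₁ * T * L ^ 2 := by rw [hK₁]; ring
  -- Step 2: `Σ s² = (TL³/2π) R F₂² + O(TL⁴)`
  have hstep2 : |S - T * L / (2 * π) * R * (L * F₂) ^ 2| ≤ (C_R + K₁) * T * L ^ 4 := by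
    have e : S - T * L / (2 * π) * R * (L * F₂) ^ 2 =
        (S - L ^ 2 * MM) + L ^ 2 * (MM - T * L / (2 * π) * R * F₂ ^ 2) := by ring
    rw [e]
    have hL2 : 0 < L ^ 2 := by positivity
    calc |(S - L ^ 2 * MM) + L ^ 2 * (MM - T * L / (2 * π) * R * F₂ ^ 2)|
        ≤ |S - L ^ 2 * MM| + |L ^ 2 * (MM - T * L / (2 * π) * R * F₂ ^ 2)| := abs_add_le _ _
      _ ≤ C_R * T * L ^ 4 + L ^ 2 * (K₁ * T * L ^ 2) := by
          rw [abs_mul, abs_of_pos hL2]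
          exact add_le_add h_red (mul_le_mul_of_nonneg_left hstep1 hL2.le)
      _ = (C_R + K₁) * T * L ^ 4 := by ring
  -- Step 3: `V := (LF₂)⁻² Σ s² = (TL/2π) R + O(T)`
  generalize hVdef : (L * F₂)⁻¹ ^ 2 * S = V at *
  have hden : m₀ ^ 2 * L ^ 4 / 4 ≤ (L * F₂) ^ 2 := by
    have h := pow_le_pow_left₀ (by positivity : 0 ≤ m₀ * L ^ 2 / 2) hnorm 2
    calc m₀ ^ 2 * L ^ 4 / 4 = (m₀ * L ^ 2 / 2) ^ 2 := by ring
      _ ≤ (L * F₂) ^ 2 := h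
  have hden0 : 0 < m₀ ^ 2 * L ^ 4 / 4 := by positivity
  have hLF2 : 0 < (L * F₂) ^ 2 := by positivity
  have hstep3 : |V - T * L / (2 * π) * R| ≤ 4 * (C_R + K₁) / m₀ ^ 2 * T := by
    have e : V - T * L / (2 * π) * R = (S - T * L / (2 * π) * R * (L * F₂) ^ 2) / (L * F₂) ^ 2 := by
      rw [← hVdef, eq_div_iff hLF2.ne']
      field_simp
    rw [e, abs_div, abs_of_pos hLF2]
    calc |S - T * L / (2 * π) * R * (L * F₂) ^ 2| / (L * F₂) ^ 2
        ≤ (C_R + K₁) * T * L ^ 4 / (L * F₂) ^ 2 := div_le_div_of_nonneg_right hstep2 hLF2.le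
      _ ≤ (C_R + K₁) * T * L ^ 4 / (m₀ ^ 2 * L ^ 4 / 4) :=
          div_le_div_of_nonneg_left (by positivity) hden0 hden
      _ = 4 * (C_R + K₁) / m₀ ^ 2 * T := by
          field_simp
  -- Step 4: the dyadic count
  have hNdy0 : 0 ≤ Ndy := le_trans (by positivity) hcount_ge
  have hcount' : |T * L / (2 * π) - Ndy| ≤ T := by rw [abs_sub_comm]; exact hcount
  have hstep4 : |V - R * Ndy| ≤ K₂ * T := by
    have e : V - R * Ndy = (V - T * L / (2 * π) * R) + R * (T * L / (2 * π) - Ndy) := by ring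
    rw [e]
    calc |(V - T * L / (2 * π) * R) + R * (T * L / (2 * π) - Ndy)|
        ≤ |V - T * L / (2 * π) * R| + |R * (T * L / (2 * π) - Ndy)| := abs_add_le _ _
      _ ≤ 4 * (C_R + K₁) / m₀ ^ 2 * T + |R| * T := by
          rw [abs_mul]
          exact add_le_add hstep3 (mul_le_mul_of_nonneg_left hcount' (abs_nonneg _))
      _ = K₂ * T := by rw [hK₂]; ring
  -- Step 5: the perturbation `‖tr G̃² − V‖ ≤ 2√V C_P/√T + C_P²/T = O(T)`
  have hVle : V ≤ (|R| + K₂) * T ^ 2 := by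
    have h1 : V ≤ R * Ndy + K₂ * T := by linarith only [(abs_le.1 hstep4).2]
    have h2 : R * Ndy ≤ |R| * Ndy := mul_le_mul_of_nonneg_right (le_abs_self R) hNdy0
    have h3 : T * L / (2 * π) ≤ T * L / 6 :=
      div_le_div_of_nonneg_left (by positivity) (by norm_num) (by linarith only [hπ])
    have hTL10 : T * 10 ≤ T * L := mul_le_mul_of_nonneg_left hL10 hT0.le
    have h4 : Ndy ≤ T * L := by linarith only [(abs_le.1 hcount).2, h3, hTL10, hT0.le]
    have hTT : T * L ≤ T * T := mul_le_mul_of_nonneg_left hLT hT0.le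
    have h5 : |R| * Ndy ≤ |R| * (T * T) := mul_le_mul_of_nonneg_left (h4.trans hTT) (abs_nonneg R)
    have h6 : K₂ * T ≤ K₂ * (T * T) := mul_le_mul_of_nonneg_left (le_mul_of_one_le_left hT0.le hT1) hK₂0
    calc V ≤ R * Ndy + K₂ * T := h1
      _ ≤ |R| * (T * T) + K₂ * (T * T) := add_le_add (h2.trans h5) h6
      _ = (|R| + K₂) * T ^ 2 := by ring
  have hsqrtV : Real.sqrt V ≤ Real.sqrt (|R| + K₂) * T := by
    calc Real.sqrt V ≤ Real.sqrt ((|R| + K₂) * T ^ 2) := Real.sqrt_le_sqrt hVle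
      _ = Real.sqrt (|R| + K₂) * T := by rw [Real.sqrt_mul (by positivity), Real.sqrt_sq hT0.le]
  have hsqrtT : 1 ≤ Real.sqrt T := by
    rw [show (1 : ℝ) = Real.sqrt 1 from Real.sqrt_one.symm]; exact Real.sqrt_le_sqrt hT1
  have hCPT : C_P / Real.sqrt T ≤ C_P := div_le_self hCP0 hsqrtT
  have hCPT0 : 0 ≤ C_P / Real.sqrt T := by positivity
  have hstep5 : ‖GG - (V : ℂ)‖ ≤ (2 * Real.sqrt (|R| + K₂) * C_P + C_P ^ 2) * T := by
    refine h_pert.trans ?_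
    have h1 : 2 * Real.sqrt V * (C_P / Real.sqrt T) ≤ 2 * (Real.sqrt (|R| + K₂) * T) * C_P :=
      mul_le_mul (mul_le_mul_of_nonneg_left hsqrtV (by norm_num)) hCPT hCPT0 (by positivity)
    have h2 : (C_P / Real.sqrt T) ^ 2 ≤ C_P ^ 2 * T := by
      calc (C_P / Real.sqrt T) ^ 2 ≤ C_P ^ 2 := pow_le_pow_left₀ hCPT0 hCPT 2
        _ ≤ C_P ^ 2 * T := le_mul_of_one_le_right (by positivity) hT1
    calc 2 * Real.sqrt V * (C_P / Real.sqrt T) + (C_P / Real.sqrt T) ^ 2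
        ≤ 2 * (Real.sqrt (|R| + K₂) * T) * C_P + C_P ^ 2 * T := add_le_add h1 h2
      _ = (2 * Real.sqrt (|R| + K₂) * C_P + C_P ^ 2) * T := by ring
  -- Step 6: assemble and convert `O(T)` into `O(N(T,2T)/L)`
  have htotal : ‖GG - ((R * Ndy : ℝ) : ℂ)‖ ≤ K₃ * T := by
    calc ‖GG - ((R * Ndy : ℝ) : ℂ)‖ ≤ ‖GG - (V : ℂ)‖ + ‖(V : ℂ) - ((R * Ndy : ℝ) : ℂ)‖ :=
          norm_sub_le_norm_sub_add_norm_sub _ _ _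
      _ ≤ (2 * Real.sqrt (|R| + K₂) * C_P + C_P ^ 2) * T + K₂ * T := by
          refine add_le_add hstep5 ?_
          rw [← Complex.ofReal_sub, Complex.norm_real, Real.norm_eq_abs]
          exact hstep4
      _ = K₃ * T := by rw [hK₃]; ring
  have hTN : T ≤ 4 * π * Ndy / L := by
    rw [le_div_iff₀ hL0]
    have h := mul_le_mul_of_nonneg_left hcount_ge (by positivity : (0 : ℝ) ≤ 4 * π)
    have e : 4 * π * (T * L / (4 * π)) = T * L := by field_simp
    linarith only [h, e]
  calc ‖GG - ((R * Ndy : ℝ) : ℂ)‖ ≤ K₃ * T := htotal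
    _ ≤ K₃ * (4 * π * Ndy / L) := mul_le_mul_of_nonneg_left hTN hK₃0
    _ = 4 * π * K₃ * Ndy / L := by ring

end Literature.NumberTheory.LFunctions

end
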